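import Literature.MathematicalPhysics.QuantumFieldTheory.Balaban1983to89.T3Thm1CarrierNative
import Literature.MathematicalPhysics.QuantumFieldTheory.Balaban1983to89.B11Prop7Assembly
import Literature.MathematicalPhysics.QuantumFieldTheory.Balaban1983to89.LatticeFieldCalculus
import HarnessLib

/-!
# `Balaban1983to89.T3SectALandauChart` — [Balaban1985Variational] SECT. A (14)–(21) AND PROPOSITION 2 — the Landau-gauge chart of
# [Balaban1985RegularSpaces] Theorem 2 around a background `U₀`, BY WHICH the variational problem in (6) is reduced to the space (19)–(21) —
# READ AT THE T³ FAMILY'S CARRIER `T3Thm1Carrier.varProblem3`: the letters (15), (16), (19) with bodies (the covariant one-form calculus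
# [Balaban1985RegularSpaces] (1.1)–(1.2) at the background, on the torus), the Sect. A–E carrier `B11.LGData` PRESENTED at the T³ objects with its
# bridge to `varProblem3`, Proposition 2 in native form, and THE KNIT: the 19200 leaf V3 `T3Thm1CarrierNative.Prop7From14At L B₃` from
# Propositions 2, 5, 6 AT THE T³ OBJECTS by name (`B11Prop7Assembly.prop7From14_of_props_cap`'s chain)

statement-level skeleton of published theorems with citation tags; proofs where landed; nothing here is a claim about the Yang–Mills mass gap

T. Bałaban, *The variational problem and background fields in renormalization group method for lattice gauge theories*, Commun. Math.
Phys. **102** (1985) 277–309 [Balaban1985Variational] (cell paper B11; «[6]» there = T. Bałaban, *Spaces of regular gauge field configurations on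
a lattice and gauge fixing conditions*, Commun. Math. Phys. **99** (1985) 75–102 [Balaban1985RegularSpaces], cell paper B8).  PDFs held:
`paper:balaban1985-cmp102-variational-background` (journal page = PDF page + 276; pp. 278, 280, 281, 299, 301 [PDF 2, 4, 5, 23, 25] read by this
seat AS IMAGES on the x2 renders `run/shared/lean/pub/pub-balaban/b2b-balaban-ref1/pages/1985-cmp102-variational-background/…-p00N-x2.png` and on the
text layer `p0023.txt`); `paper:balaban1985-cmp99-regular-spaces-gauge-fixing` (journal page = PDF page + 74; pp. 76–77, 79–84 [PDF 2–3, 5–10] read on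
the text layer, pp. 82–83 [PDF 8–9] AS IMAGES).

CITATION HEADER (lean-in-tree rule 2026-08-18).  WHAT IS REPRODUCED.  The typed statements of record are `B11.Prop2Printed` (Prop. 2 p. 281 over
the abstract Sect. A–E carrier `B11.LGData`), `B11.Prop5Printed`, `B11.Prop6Printed`, `B8.Thm2Printed` ([6] Thm 2 p. 83 over `B8.GFData`) and —
for the domain sequence `Ω_j = T_η` of this carrier, with (1.35)–(1.39) concrete on the periodic-`ℤᵈ` reading of the torus — `B8Thm2TorusAt.Thm2TorusAt`
∕ `Concl2T` (seat `lit-balaban-type-B8` gen 2; Thm 4: `B8Thm4TorusAt.Thm4TorusAt`), the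
assembly `B11Prop7Assembly` (Prop. 7 ⇐ Props 2, 5, 6 + `Bridge.Laws` + `ExistenceLeavesCap`), and the d = 3 carrier `T3Thm1Carrier.varProblem3` ∕
`famX` with `T3Thm1CarrierNative.Prop7From14At` (= the hypothesis `H7` = leaf V3 of the ym3 item stmt-QuantumFields-19200).  THIS FILE is the
typer's service to the V3 provers (director-ym R141 (B), seat `lit-balaban-type-B11` gen 2; asked for by name on the ym-fleet bus 2026-08-26
17:44Z «a hypothesis schema `GaugeChartT3At`», paper owner type-B8 GO 17:25Z): Sect. A of [7] — the place where [6] Thm 2 enters — at the d = 3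
carrier, so that V3 = Props 2, 5, 6 + located leaves AT THE T³ OBJECTS, by name, and Prop. 2 (the chart) is a lattice statement about `SU(2)`
configurations of the family.

THE PRINT (verbatim).  p. 280 [PDF 4]: *«We assume that we have a configuration U₀ satisfying U₀ ∈ 𝔘_k({Ω_j}, C₁B₃ε₁), |Ū₀ʲ − V| < C₁ε₁ on Λ_j,
j = 0, 1, …, k, (14) for some absolute constant C₁. The configuration U₀ constructed above satisfies (14) with C₁ = L³. … An arbitrary element of
this space can be represented as U = U′U₀, U′ = UU₀⁻¹. (15) A gauge transformation u applied to U implements the following transformation of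
U′^u(x, x′) = u(x)U′(x, x′)R(U₀(x, x′))u⁻¹(x′), (16) if U₀ is fixed in the representation (15). … Now we choose a gauge in the space (6). Using the
transformations (16) with u satisfying (4) we fix the axial gauge conditions Ax_k(𝔅_k, U₀) (see the definition (1.19) in [6]). The functional (5) is
gauge invariant, hence it is enough to consider it on the space 𝔘_k({Ω_j}, ε₀) ∩ 𝔅_k(𝔅_k, V) ∩ Ax_k(𝔅_k, U₀). (18) Next we apply the results of the
paper [6], especially the Theorem 2. Configurations U from the space (18), and U₀, satisfy the assumptions (1.33)–(1.35) of this theorem with α₀ = ε₀,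
α₁ = C₁ε₁. The additional regularity condition (3.35) in (1.33) is satisfied for U₀ also, because of the result of Sect. F. Thus for ε₀, ε₁ sufficiently
small, more»* p. 281 [PDF 5]: *«exactly for ε₀ + C₁ε₁ ≦ c₁, and for an arbitrary configuration U = U′U₀ from (18) there exists exactly one gauge
transformation u satisfying \overline{R₀u}ʲ = 1 on Λ_j, j = 0, 1, …, k (thus u = 1 on Λ₀), such that U₁ = U′^{u⁻¹} satisfies the conditions
(1.36)–(1.39) of [6]. These gauge transformations define a mapping of the space (18) into a space of gauge field configurations U₁U₀ with U₁
satisfying the conditions U₁ = e^{iηA}, |A| < ε₂(Lʲη)⁻¹, |∇^η_{U₀}A| < ε₂(Lʲη)⁻², |D^{η*}_{U₀}D^η_{U₀}A|, |Δ^η_{U₀}A| < ε₂(Lʲη)⁻³ on Ω_j, j = 0, 1, …, k,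
(19) Q_j(U₀, ηA) = B on Λ_j, j = 0, 1, …, k, (20) where B is given by the formulas (1.31) in [6], hence |B| < 2dLC₁ε₁, R(U₀)D^{η*}_{U₀}A = 0, (21) with
ε₂ ≧ B₁(ε₀ + C₁ε₁). The projection operator R(U₀) determining the Landau gauge condition (21) was defined in [5, 6]. The above mapping is one-to-one,
hence using again the gauge invariance of the functional (5), we have reduced a proof of the existence and the uniqueness of critical configurations in
the space (18), to a proof of the existence and the uniqueness in the space of configurations U₁U₀ satisfying (19)–(21). Let us summarize the
discussion of this section in. Proposition 2. All critical orbits of the functional (5) in the space (6), or all critical configurations of this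
functional in the space (18), can be obtained by taking critical configurations U₁ of the functional A(U₁U₀) in the space defined by (19)–(21), where
U₀ satisfies (14), and transforming them to the axial gauge Ax_k(𝔅_k, U₀) by gauge transformations u satisfying the conditions \overline{R₀u}ʲ = 1 on
Λ_j, 0, 1, …, k.»*  [6] p. 76 [PDF 2] (1.1): *«(D^η_{U,μ}F)(x) = η⁻¹(R(U(x, x + ηe_μ))F(x + ηe_μ) − F(x)), (D^{η*}_{U,μ}F)(x) = η⁻¹(R(U(x, x − ηe_μ))F(x − ηe_μ) −
F(x)), where U is an arbitrary gauge field configuration, and R(U)X = UXU⁻¹»*; (1.2): *«(D^{η*}_U F)(x, x + ηe_μ) = (D^{η*}_U F)_μ(x) = Σ_{ν<μ}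
(D^{η*}_{U,ν}F_{νμ})(x) − Σ_{ν>μ}(D^{η*}_{U,ν}F_{μν})(x)»*.

WHAT IS CERTIFIED (kernel, sorry-free; axioms `propext` ∕ `Classical.choice` ∕ `Quot.sound`; no instance, no notation, no named fact).
§1 Letters with bodies on `Site (F.P K) 0`: `eta` (= `varProblem3.eta`, `rfl`); (15) `pert U₀ U = UU₀⁻¹`, `emb15 U₀ U′ = U′U₀` (inverse bijections);
   (16) `act16` with **`act16_eq`** ∕ `pert_gaugeAct`: (16) IS the tree's gauge action `GaugeField.gaugeAct` on `U = U′U₀` read on `U′`; `emb15_act16`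
   (p. 299 «U_k = (U₁U₀)^u»).
§2 The covariant one-form calculus at a background on any torus `T^{(s)}`, values in the units of a normed `ℂ`-algebra (the letters of
   `B10Eq68TorusRegularity` §6, whose backward `covDerivT`, `plaqFT`, `covDivT` are used BY NAME): forward derivative `covDerivFwdT` ((1.1) first
   line), `covGradT` (∇_U on one-forms), `covCurlT` (D_U on one-forms), `covCodiffT` ((1.2) for a general plaquette function; `covCodiffT_plaqFT`:
   = `covDivT` at `∂U`, `rfl`), `covCodiffCurlT` (D*_U D_U), `covLapFormT` (Δ_U), `covDivFormT` (D*_U on one-forms); `η`-bookkeeping `D^η = η⁻¹D¹`;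
   **AT THE TRIVIAL BACKGROUND THEY ARE THE FLAT OPERATORS OF `LatticeFieldCalculus`** (`covDerivFwdT_one` = `pdiff`, `covDerivT_one` = `pdiffAdj`,
   `covDivFormT_one` = `diverg`, `covCurlT_one` = `curl`, `covLapFormT_one` = `laplace`, factor `η⁻¹`) — the vocabulary of the 19200 V3-♭ files;
   the zero one-form is annihilated.
§3 (14) with body: `CloseAvg` («|Ū₀ − V| < b» through the family's descent `descendTo`), **`Sat14T3 a b V U₀ := RegPr a U₀ ∧ CloseAvg b V U₀`**,
   `sat14T3_of_mem_fibre` (the background of (13), `U₀ ∈ 𝔘_k(a) ∩ 𝔅_k(V)`, has (14) for every `b > 0`); **(19) with body, η-free form `In19 ε₂ U₀ U₁ X`**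
   (`X = ηA` Hermitian traceless, `U₁ = exp(iX)` bondwise, `‖X‖ < ε₂η`, `‖∇¹_{U₀}X‖ < ε₂η²`, `‖D^{1*}_{U₀}D¹_{U₀}X‖, ‖Δ¹_{U₀}X‖ < ε₂η³`, `η = L^{−(K−n)}`, top
   scale — the member `j = k` of (19), which implies the members `j < k`: `In19.norm_lt_scale`).
§4 `Resid F n K` — the operators of Sects. A–E NOT typed at the T³ objects, as ONE presentation structure (never asserted): `IsAxial` ((18) third
   member, [6] (1.19)), `Restricted` ((1.29)), `AvgCond` ((20)), `IsLandau` ((21)), `CritL` («critical in the space (19)–(21)»), and the Sect. C–E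
   letters of `B11.LGData` verbatim.
§5 **`lgData3 F n K h S : B11.LGData`** — the Sect. A–E carrier AT THE T³ OBJECTS (Sect. A fields with bodies: `Sat14` = `Sat14T3`, `In18` = «U′U₀ ∈
   `regFibrePr ε₀ V` ∧ `S.IsAxial U₀ (U′U₀)`», `Crit` = reading R2 `IsCritR2` of `U′U₀`, `In19_21` = `∃ X, In19 ∧ S.AvgCond ∧ S.IsLandau`, `toAxial` =
   `act16`; the rest from `S`), **`bridge3 : B11Prop7Assembly.Bridge (varProblem3 F n K h) (lgData3 F n K h S)`** (`bdry = id`, `emb = emb15`), and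
   the `Iff.rfl` unfoldings.
§6 The bridge laws: **the group (4) PROVED** (`descTransf_inv ∕ _mul ∕ _one`, `sameOrbit_refl ∕ _symm ∕ _trans` for `T3Thm1Carrier.SameOrbit`),
   `pos_of_regPr`, **`isCritR2_gaugeAct_of_trivial`** (reading R2 is constant on (4)-orbits: p. 280 «The functional (5) is gauge invariant, hence it
   is enough to consider it on the space (18)»); the two located sentences PRESENTED as laws on `S` (`AxialRepr`: p. 280 + [6] p. 79 «The conditions
   (1.19) determine uniquely an element in each orbit given by the subgroup (1.14)», existence half; `Orbit16`: the LQB law `orbit16` = p. 281 «The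
   above mapping is one-to-one» in the LQB reading); **`bridge3_laws : AxialRepr → Orbit16 → (bridge3 …).Laws C₁ B₃`**.
§7 **`Prop2NativeAt L S B₁ B₃ C₁ c₁`** — PROPOSITION 2 = THE CHART, NATIVE, and **`prop2Printed_famLG3_iff_native : B11.Prop2Printed B₁ B₃ C₁ c₁
   (famLG3 L S) ↔ Prop2NativeAt L S B₁ B₃ C₁ c₁`** (pure unfolding through (15)–(16)).
§8 **THE KNIT `prop7From14At_of_props`**: `1 < L`, laws + capped leaves for every member, `Prop2Printed ∧ Prop5Printed ∧ Prop6Printed` at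
   `famLG3 L S` with `C₁ = L³` (constants `B₀, B₁ > 0`, `B₃ ≧ 1`, `B₀ ≦ 4B₁`, `c₁ > 0`, `O₁, O₂ ≧ 1`, `e₅ > 0`) ⟹ `Prop7From14At L B₃`; via
   `B11Prop7Assembly.atMostOneCriticalOrbit_of_props` BY NAME and `exists_minimalOrbit_of_prop6_cap_explicit` (the LQB existence assembly re-run
   with «O(1) = O₂O₁» displayed, which `H7` needs `≧ 1`); `prop7From14At_of_props_of_located` (laws from `AxialRepr`, `Orbit16`).
§9 Non-vacuity at the flat datum: `in19_one_zero`, `sat14T3_one`.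
§10 (v1.1, append-only) The chart in the consumers' exp-free letters at the trivial background: **`In19.norm_sub_one_lt`** (`‖U₁(b) − 1‖ <
   ε₂L^{−(K−n)}` from (19) by [Balaban1985Averaging] (24) `|e^{iA} − 1| ≦ |A|` — the bond radius `hδ` of the 19200 file
   `Prop7FlatLocalMin.wilsonAction4_ge_of_regPr_T3`), `bgUnits_one`, `pert_one`, `emb15_one`, and **`in19_one_iff`** ((19) at `U₀ = 1` with the
   gradient and Laplacian members literally `LatticeFieldCalculus.pdiff 1` ∕ `laplace 1`).

LOCATED FINDING for the 19200 V3 provers (count-neutral; print vs the consumer's sketch on the ym-fleet bus 17:44Z «∃ u A, descTransf u = 1 ∧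
gaugeAct u U = expField A * U₀ ∧ … ∧ Landau U₀ A»).  (a) Print's chart transformation `u` is NOT in the group (4) «u(y) = 1 for y ∈ 𝔅_k»: it is
restricted by the AVERAGED condition (1.29) «\overline{R₀u}ʲ = 1» ([6] p. 80: *«The allowed gauge transformations u are restricted by the conditions
(1.14): u(y) = 1, y ∈ 𝔅_k. These conditions are very hard to work with analytically and we have to replace them by conditions imposed on some
averages of u rather than on values of u at the points of 𝔅_k»*); only the PRELIMINARY axial gauge fixing uses (4).  (b) The chart's image `U₁U₀`
is NOT in the fibre `𝔅_k(𝔅_k, V)`: it satisfies the nonlinear averaged constraint (20) instead ([6] p. 81: *«The set Σ_k is not contained in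
𝔅_k(𝔅_k, V) because the gauge transformations u do not satisfy the necessary conditions (1.14)»*); in the T³ case `U₀ ∈ 𝔅_k(V)` gives `B = 0` in (20)
((1.31) with `V′ = V(Ū₀ᵏ)⁻¹ = 1`).  (c) The Landau condition (21) is the PROJECTED one, `R(U₀) =` the orthogonal projection onto `Δ^η_{U₀}N(Q′(U₀))`
([6] p. 80), not `D^{η*}_{U₀}A = 0`; at the trivial background it is `R(1)∂*X = 0`, weaker than the V3-F♭ files' `∂*X = 0` (their CARD's D1b′ remark).
(d) What transfers uniqueness from (19)–(21) back to (6) is the injectivity sentence «The above mapping is one-to-one» + Prop. 2, carried in the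
tree as the located law `orbit16` of `B11Prop7Assembly.Bridge.Laws` (here `Orbit16`, presented).  (e) (19) as printed in [7] carries NO Hölder member
(the Hölder member of [6] (1.36), `β ≦ β₀ < 1`, is not transported into (19) by print: «ε₂ ≧ B₁(ε₀ + C₁ε₁)» uses `B₁`'s members only) — nothing is
dropped here relative to (19).

HONEST SCOPE — what is NOT claimed.  Nothing of [7] or [6] is proved or asserted: Prop. 2 ∕ [6] Thm 2, Props 5, 6 and the leaves of pp. 296–299
are HYPOTHESES of §8 (typed statements of record ∕ located structures of `B11Prop7Assembly`).  The operators of §4 have no body here; every result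
of §§5–8 holds for EVERY presentation `S`, and acquires its printed content only when `S` is instantiated by torus definitions of [6] (1.19),
(1.29) ∕ [Balaban1985Averaging] (78)–(80), (20) ∕ [Balaban1985Averaging] (85)–(91), (21) ∕ [6] p. 80, and of Sects. C–E — OWED, not in the tree at the
T³ objects (the `ℤ^d` twins `B8Eq119TwistedAxial`, `B7Eq84Concrete`, `B7Eq92Concrete`, `B8Eq138LandauZd` exist); a junk presentation makes the
hypotheses of §8 vacuous or unsatisfiable, never the conclusion false.  `Orbit16` (= LQB's `orbit16`) is stronger than print's injectivity sentence
as a law over all `U₁, u, u′` (`B11Prop7Assembly` §1 docstring); it is presented, not proved.  Criticality of (5) is `T3Thm1Carrier`'s reading R2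
throughout (weaker than print, declared there); «critical in the space (19)–(21)» is the presented `S.CritL` (an intermediary between Prop. 2's
conclusion and Prop. 5's hypothesis, `B11Prop7Assembly.one_landau_of_props`).  (19) is typed at the top scale `j = k` in η-free form (the `j < k`
members follow); the second half of (1.33) («(3.35) in [4]») is print's consequence ([6] Prop. 6), not a clause of (14).  The T³ carrier is the pure
small-field case «Ω_j = T_η for j = 0, 1, …, k» admitted on [6] p. 77 (no boundary layers: the refutation `B8LeafModelZd3Boundary.not_thm2Printed_zdGF3`
of `B8.Thm2Printed` on members with a boundary layer does not bear on it).  Mega-formalization `lit-balaban`, HOME `run/shared/lean/pub/lit-balaban/`;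
consumers: ym3 `stmt-QuantumFields-19200` leaf V3 (fleet seats `ym-ust-19200-p1∕-p2`, owner `ym3-torus-plan`).  Imports `T3Thm1CarrierNative`,
`B11Prop7Assembly`, `LatticeFieldCalculus`; modifies nothing; net new unproved facts: 0.

References: T. Bałaban, CMP 102 (1985) 277–309 [Balaban1985Variational] ((4)–(6) p.278, (13)–(18) p.280, (19)–(21) and Prop. 2 p.281, Props 5–6
pp.294–295, (122) p.296, Prop. 7 and (141) p.299); CMP 99 (1985) 75–102 [Balaban1985RegularSpaces] ((1.1)–(1.2) p.76, (1.7)–(1.9) p.77, (1.19)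
p.79, (1.27) p.80, (1.29) p.81, (1.33)–(1.39) pp.82–83, Thm 2 p.83, (1.47) p.84); CMP 98 (1985) 17–51 [Balaban1985Averaging] ((8), (11)–(13), (19)
pp.19–21, (78)–(91) pp.29–31); CMP 95 (1984) 17–40 [Balaban1984PropagatorsI] ((1.1)–(1.2) p.18, (1.21) p.21).
-/

noncomputable section

open MeasureTheory Filter Topology
open scoped Matrix.Norms.L2Operator
open Literature.MathematicalPhysics.QuantumFieldTheory.Balaban1983to89.T3ContinuumYM3Torus
open Literature.MathematicalPhysics.QuantumFieldTheory.Balaban1983to89.T3UnitLawDensityEML (ℰp measurableE_ℰp)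
open Literature.MathematicalPhysics.QuantumFieldTheory.Balaban1983to89.T3UnitScaleTilt
open Literature.MathematicalPhysics.QuantumFieldTheory.Balaban1983to89.T3TiltDescent
open Literature.MathematicalPhysics.QuantumFieldTheory.Balaban1983to89.T3CruxEstimates
open Literature.MathematicalPhysics.QuantumFieldTheory.Balaban1983to89.T3ConstrainedMinimiser
open Literature.MathematicalPhysics.QuantumFieldTheory.Balaban1983to89.T3DescentFibreTower
open Literature.MathematicalPhysics.QuantumFieldTheory.Balaban1983to89.T3RegularMinimiser
open Literature.MathematicalPhysics.QuantumFieldTheory.Balaban1983to89.T3PrintedRegularMinimiser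
open Literature.MathematicalPhysics.QuantumFieldTheory.Balaban1983to89.T3LowerAlongMinimisersSplit (L_cast_pos)
open Literature.MathematicalPhysics.QuantumFieldTheory.Balaban1983to89.T3PrintedRegularOrbits (descTransf descendTo_gaugeAct
  gaugeAct_mem_regFibrePr_iff_of_trivial gaugeAct_mem_fibre_iff_of_trivial regPr_gaugeAct_iff)
open Literature.MathematicalPhysics.QuantumFieldTheory.Balaban1983to89.T3UnitLawGaugeInvariance (gaugeAct_gaugeAct)
open Literature.MathematicalPhysics.QuantumFieldTheory.Balaban1983to89.B10Eq27TorusAxialLog (toUField unitsField val_unitsField)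
open Literature.MathematicalPhysics.QuantumFieldTheory.Balaban1983to89.B10Eq68TorusRegularity (plaqFT covDerivT covDivT)
open Literature.MathematicalPhysics.QuantumFieldTheory.Balaban1983to89.B7Eq78Linearization (conjR conjR_apply)
open Literature.MathematicalPhysics.QuantumFieldTheory.Balaban1983to89.B11 (VarProblem VarProblemX LGData Prop2Printed Prop5Printed
  Prop6Printed)
open Literature.MathematicalPhysics.QuantumFieldTheory.Balaban1983to89.B11Prop7Assembly (Bridge ExistenceLeavesCap
  atMostOneCriticalOrbit_of_props)
open Literature.MathematicalPhysics.QuantumFieldTheory.Balaban1983to89.T3Thm1Carrier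
open Literature.MathematicalPhysics.QuantumFieldTheory.Balaban1983to89.T3Thm1CarrierNative (IsCritR2 Prop7From14At)
open Literature.MathematicalPhysics.QuantumFieldTheory.Balaban1983to89.Missing
open NormedSpace

namespace Literature.MathematicalPhysics.QuantumFieldTheory.Balaban1983to89.T3SectALandauChart


/-! ## §1 The letters of Sect. A at the T³ objects, with bodies: `η`, (15), (16) -/

section Letters

variable (F : T3Family) (n K : ℕ)

/-- **PRINT's `η = L^{−k}`** for the pure small-field problem of run `K` over the comparison height `n` (`k = K − n`; the field `eta` of
`T3Thm1Carrier.varProblem3`, here without the proof argument `n ≤ K`). [cite: Balaban1985Variational, (2) and (5) p.278] -/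
def eta : ℝ := ((F.L : ℝ)⁻¹) ^ (K - n)

/-- `η > 0`. [cite: Balaban1985Variational, (5) p.278] -/
theorem eta_pos : 0 < eta F n K := pow_pos (inv_pos.mpr (L_cast_pos F)) _

/-- `η` IS the carrier's `eta` (definitional). [cite: Balaban1985Variational, (5) p.278] -/
theorem varProblem3_eta (h : n ≤ K) : (varProblem3 F n K h).eta = eta F n K := rfl

/-- `η² = L^{−2(K−n)}` and `η³ = L^{−3(K−n)}` (bookkeeping between print's powers of `η` and the η-free thresholds of `RegPr`/`DivSmall`).
[cite: Balaban1985Variational, (2) p.278] -/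
theorem eta_pow (a : ℕ) : eta F n K ^ a = ((F.L : ℝ)⁻¹) ^ (a * (K - n)) := by
  rw [eta, ← pow_mul, mul_comm]

variable {F n K}

/-- **(15) «U = U′U₀, U′ = UU₀⁻¹»**: the perturbation `U′` of the background `U₀` representing the configuration `U` (bondwise, in `SU(2)`).
[cite: Balaban1985Variational, (15) p.280] -/
def pert (U₀ U : GaugeField (F.P K) 0 (Matrix.specialUnitaryGroup (Fin 2) ℂ)) :
    GaugeField (F.P K) 0 (Matrix.specialUnitaryGroup (Fin 2) ℂ) := fun b => U b * (U₀ b)⁻¹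

/-- **(15) read the other way**: the configuration `U = U′U₀` built from the background `U₀` and the perturbation `U′` (this is the map
`emb` of the bridge `B11Prop7Assembly.Bridge` at the T³ objects). [cite: Balaban1985Variational, (15) p.280] -/
def emb15 (U₀ U' : GaugeField (F.P K) 0 (Matrix.specialUnitaryGroup (Fin 2) ℂ)) :
    GaugeField (F.P K) 0 (Matrix.specialUnitaryGroup (Fin 2) ℂ) := fun b => U' b * U₀ b

/-- `(UU₀⁻¹)U₀ = U`. [cite: Balaban1985Variational, (15) p.280] -/
theorem emb15_pert (U₀ U : GaugeField (F.P K) 0 (Matrix.specialUnitaryGroup (Fin 2) ℂ)) : emb15 U₀ (pert U₀ U) = U := by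
  funext b; simp [emb15, pert]

/-- `(U′U₀)U₀⁻¹ = U′`. [cite: Balaban1985Variational, (15) p.280] -/
theorem pert_emb15 (U₀ U' : GaugeField (F.P K) 0 (Matrix.specialUnitaryGroup (Fin 2) ℂ)) : pert U₀ (emb15 U₀ U') = U' := by
  funext b; simp [emb15, pert]

/-- **(16) «U′^u(x, x′) = u(x)U′(x, x′)R(U₀(x, x′))u⁻¹(x′), if U₀ is fixed in the representation (15)»** (`R(U)X = UXU⁻¹`): the
transformation of the perturbation implemented by a gauge transformation `u` of `U = U′U₀` with the background kept fixed.
[cite: Balaban1985Variational, (16) p.280] -/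
def act16 (U₀ : GaugeField (F.P K) 0 (Matrix.specialUnitaryGroup (Fin 2) ℂ))
    (u : GaugeTransf (F.P K) 0 (Matrix.specialUnitaryGroup (Fin 2) ℂ))
    (U' : GaugeField (F.P K) 0 (Matrix.specialUnitaryGroup (Fin 2) ℂ)) :
    GaugeField (F.P K) 0 (Matrix.specialUnitaryGroup (Fin 2) ℂ) :=
  fun b => u b.src * U' b * (U₀ b * (u b.tgt)⁻¹ * (U₀ b)⁻¹)

/-- **(16) IS THE GAUGE ACTION ON `U = U′U₀` READ ON `U′`**: `U′^u = (U′U₀)^u U₀⁻¹` ([Balaban1985Averaging] (8) `U^u(x, x′) = u(x)U(x, x′)u(x′)⁻¹`,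
the tree's `GaugeField.gaugeAct`). [cite: Balaban1985Variational, (16) p.280; Balaban1985Averaging, (8) p.19] -/
theorem act16_eq (U₀ : GaugeField (F.P K) 0 (Matrix.specialUnitaryGroup (Fin 2) ℂ))
    (u : GaugeTransf (F.P K) 0 (Matrix.specialUnitaryGroup (Fin 2) ℂ))
    (U' : GaugeField (F.P K) 0 (Matrix.specialUnitaryGroup (Fin 2) ℂ)) :
    act16 U₀ u U' = pert U₀ (GaugeField.gaugeAct u (emb15 U₀ U')) := by
  funext b; simp only [act16, pert, emb15, GaugeField.gaugeAct, mul_assoc]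

/-- (16) verbatim as a property of `pert`: `(U^u)U₀⁻¹ = u(x)·(UU₀⁻¹)(x, x′)·R(U₀(x, x′))u(x′)⁻¹`. [cite: Balaban1985Variational, (16) p.280] -/
theorem pert_gaugeAct (U₀ U : GaugeField (F.P K) 0 (Matrix.specialUnitaryGroup (Fin 2) ℂ))
    (u : GaugeTransf (F.P K) 0 (Matrix.specialUnitaryGroup (Fin 2) ℂ)) :
    pert U₀ (GaugeField.gaugeAct u U) = act16 U₀ u (pert U₀ U) := by
  rw [act16_eq, emb15_pert]

/-- `(U₁U₀)^u = U′U₀` for `U′ = U₁^u` in the sense (16) — the form in which p. 299 uses (16): «U_k = (U₁U₀)^u».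
[cite: Balaban1985Variational, (16) p.280, p.299 (before (141))] -/
theorem emb15_act16 (U₀ : GaugeField (F.P K) 0 (Matrix.specialUnitaryGroup (Fin 2) ℂ))
    (u : GaugeTransf (F.P K) 0 (Matrix.specialUnitaryGroup (Fin 2) ℂ))
    (U₁ : GaugeField (F.P K) 0 (Matrix.specialUnitaryGroup (Fin 2) ℂ)) :
    emb15 U₀ (act16 U₀ u U₁) = GaugeField.gaugeAct u (emb15 U₀ U₁) := by
  rw [act16_eq, emb15_pert]

end Letters

/-! ## §2 The covariant one-form calculus at a background ([Balaban1985RegularSpaces] (1.1)–(1.2)) for bond fields on a torus `T^{(s)}`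

The backward derivative `covDerivT`, the plaquette field `plaqFT` and the covariant divergence `covDivT` of the background's own plaquette field are
`B10Eq68TorusRegularity`'s (§6 there), used BY NAME.  Added here, on the same carrier and in the same letters (`V : GaugeField P s 𝔸ˣ`,
`R(U)X = UXU⁻¹` = `B7Eq78Linearization.conjR`, spacing parameter `η`): the FORWARD derivative (first line of (1.1)) and — for a ONE-FORM
`X : bonds → 𝔸` read componentwise as the site functions `X_ν(x) = X(⟨x, x + e_ν⟩)` — the covariant gradient `∇_U X = {D_{U,μ}X_ν}_{μν}`, the
covariant curl `(D_U X)(p_{μν}(x)) = (D_{U,μ}X_ν)(x) − (D_{U,ν}X_μ)(x)`, the codifferential (1.2) of a general plaquette function, `D*_U D_U X`, the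
covariant Laplacian `Δ_U X_ν = Σ_μ D*_{U,μ}D_{U,μ}X_ν` and the covariant divergence `D*_U X = Σ_μ D*_{U,μ}X_μ`: the operators NAMED in
[Balaban1985Variational] (19) and (21) (and in [Balaban1985RegularSpaces] (1.36), (1.38), (1.39)).  At the trivial background they ARE the flat
operators of `LatticeFieldCalculus` (`pdiff`, `pdiffAdj`, `curl`, `diverg`, `laplace` with lattice factor `c = η⁻¹`): §2.2. -/

section Calculus

variable {P : Params} {s : ℕ} {𝔸 : Type*} [NormedRing 𝔸] [NormedAlgebra ℂ 𝔸]

/-- **[6] (1.1), first line, ON THE TORUS**: the forward covariant derivative `(D^η_{U,μ}F)(x) = η⁻¹(R(U(x, x + ηe_μ))F(x + ηe_μ) − F(x))`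
(`R(U)X = UXU⁻¹`; twin of `B10Eq68TorusRegularity.covDerivT`, the backward one). [cite: Balaban1985RegularSpaces, (1.1) p.76] -/
def covDerivFwdT (η : ℝ) (V : GaugeField P s 𝔸ˣ) (μ : Fin P.d) (G : Site P s → 𝔸) (x : Site P s) : 𝔸 :=
  η⁻¹ • (conjR (V ⟨x, μ⟩) (G (x.shift μ)) - G x)

/-- The `ν`-component of a one-form `X` (bond field) as a site function, `X_ν(x) = X(⟨x, x + e_ν⟩)` ([Balaban1984PropagatorsI] (1.1) «vector
fields … A_μ(x) = A(⟨x, x + e_μ⟩)»). [cite: Balaban1984PropagatorsI, (1.1) p.18] -/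
def formComp (X : PBond P s → 𝔸) (ν : Fin P.d) : Site P s → 𝔸 := fun x => X ⟨x, ν⟩

/-- **THE COVARIANT GRADIENT `∇^η_U X` OF A ONE-FORM**: its `(μ, ν)` component `(D^η_{U,μ}X_ν)(x)` — the quantity of «|∇^η_{U₀}A|» in
[Balaban1985Variational] (19) ∕ [Balaban1985RegularSpaces] (1.36). [cite: Balaban1985Variational, (19) p.281; Balaban1985RegularSpaces, (1.1) p.76] -/
def covGradT (η : ℝ) (V : GaugeField P s 𝔸ˣ) (X : PBond P s → 𝔸) (μ ν : Fin P.d) (x : Site P s) : 𝔸 :=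
  covDerivFwdT η V μ (formComp X ν) x

/-- **THE COVARIANT CURL `D^η_U X` OF A ONE-FORM** (a plaquette function): `(D^η_U X)(p_{μν}(x)) = (D^η_{U,μ}X_ν)(x) − (D^η_{U,ν}X_μ)(x)` — the
covariant version of [Balaban1984PropagatorsI] (1.2) `F_{μν} = ∂_μA_ν − ∂_νA_μ`, the first-order term of [Balaban1985RegularSpaces] (1.47)
`(∂_{U₀}U₁)(p) − 1 = iη(D^η_{U₀}ηA)(p) − …`. [cite: Balaban1985RegularSpaces, (1.47) p.84; Balaban1984PropagatorsI, (1.2) p.18] -/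
def covCurlT (η : ℝ) (V : GaugeField P s 𝔸ˣ) (X : PBond P s → 𝔸) (μ ν : Fin P.d) (x : Site P s) : 𝔸 :=
  covGradT η V X μ ν x - covGradT η V X ν μ x

/-- **[6] (1.2) FOR A GENERAL PLAQUETTE FUNCTION** `F` (given by its values `F_{μν}(x) = F(p_{μν}(x))`, `μ < ν`):
`(D^{η*}_U F)_μ(x) = Σ_{ν<μ}(D^{η*}_{U,ν}F_{νμ})(x) − Σ_{ν>μ}(D^{η*}_{U,ν}F_{μν})(x)` (`B10Eq68TorusRegularity.covDivT` is the case `F = ∂U`).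
[cite: Balaban1985RegularSpaces, (1.2) p.76] -/
def covCodiffT (η : ℝ) (V : GaugeField P s 𝔸ˣ) (Fp : Fin P.d → Fin P.d → Site P s → 𝔸) (μ : Fin P.d) (x : Site P s) : 𝔸 :=
  ∑ ν ∈ Finset.Iio μ, covDerivT η V ν (Fp ν μ) x - ∑ ν ∈ Finset.Ioi μ, covDerivT η V ν (Fp μ ν) x

/-- (1.2) at the background's own plaquette field IS `B10Eq68TorusRegularity.covDivT` (definitional). [cite: Balaban1985RegularSpaces, (1.2) p.76] -/
theorem covCodiffT_plaqFT (η : ℝ) (V : GaugeField P s 𝔸ˣ) (μ : Fin P.d) (x : Site P s) :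
    covCodiffT η V (plaqFT V) μ x = covDivT η V μ x := rfl

/-- **`D^{η*}_U D^η_U X`** — the first second-order operator of [Balaban1985Variational] (19) ∕ [Balaban1985RegularSpaces] (1.39) (the
codifferential (1.2) of the covariant curl of the one-form). [cite: Balaban1985Variational, (19) p.281; Balaban1985RegularSpaces, (1.39) p.83] -/
def covCodiffCurlT (η : ℝ) (V : GaugeField P s 𝔸ˣ) (X : PBond P s → 𝔸) (μ : Fin P.d) (x : Site P s) : 𝔸 :=
  covCodiffT η V (covCurlT η V X) μ x

/-- **THE COVARIANT LAPLACIAN `Δ^η_U X`** on the `ν`-component of a one-form, `Σ_μ D^{η*}_{U,μ}D^η_{U,μ}X_ν` (positive lattice Laplacian,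
[Balaban1984PropagatorsI] (1.21) «Δ is η-lattice Laplace operator», covariant as in [Balaban1985RegularSpaces] (1.39)) — the second second-order
operator of (19). [cite: Balaban1985Variational, (19) p.281; Balaban1985RegularSpaces, (1.39) p.83] -/
def covLapFormT (η : ℝ) (V : GaugeField P s 𝔸ˣ) (X : PBond P s → 𝔸) (ν : Fin P.d) (x : Site P s) : 𝔸 :=
  ∑ μ : Fin P.d, covDerivT η V μ (covDerivFwdT η V μ (formComp X ν)) x

/-- **THE COVARIANT DIVERGENCE `D^{η*}_U X` OF A ONE-FORM**, `Σ_μ (D^{η*}_{U,μ}X_μ)(x)` — the quantity the Landau condition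
[Balaban1985Variational] (21) ∕ [Balaban1985RegularSpaces] (1.38) `R(U₀)D^{η*}_{U₀}A = 0` projects. [cite: Balaban1985Variational, (21) p.281; Balaban1985RegularSpaces, (1.38) p.82] -/
def covDivFormT (η : ℝ) (V : GaugeField P s 𝔸ˣ) (X : PBond P s → 𝔸) (x : Site P s) : 𝔸 :=
  ∑ μ : Fin P.d, covDerivT η V μ (formComp X μ) x

/-! ### §2.1 The `η`-bookkeeping: `D^η = η⁻¹D^1` -/

/-- `D^η_{U,μ} = η⁻¹·D^1_{U,μ}` (the prefactor of (1.1) is the only place the spacing enters). [cite: Balaban1985RegularSpaces, (1.1) p.76] -/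
theorem covDerivFwdT_eq_smul (η : ℝ) (V : GaugeField P s 𝔸ˣ) (μ : Fin P.d) (G : Site P s → 𝔸) (x : Site P s) :
    covDerivFwdT η V μ G x = η⁻¹ • covDerivFwdT 1 V μ G x := by
  simp only [covDerivFwdT, inv_one, one_smul]

/-- `∇^η_U = η⁻¹·∇^1_U`. [cite: Balaban1985RegularSpaces, (1.1) p.76] -/
theorem covGradT_eq_smul (η : ℝ) (V : GaugeField P s 𝔸ˣ) (X : PBond P s → 𝔸) (μ ν : Fin P.d) (x : Site P s) :
    covGradT η V X μ ν x = η⁻¹ • covGradT 1 V X μ ν x :=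
  covDerivFwdT_eq_smul η V μ _ x

/-- `D^η_U X = η⁻¹·D^1_U X` on plaquettes. [cite: Balaban1985RegularSpaces, (1.1) p.76] -/
theorem covCurlT_eq_smul (η : ℝ) (V : GaugeField P s 𝔸ˣ) (X : PBond P s → 𝔸) (μ ν : Fin P.d) (x : Site P s) :
    covCurlT η V X μ ν x = η⁻¹ • covCurlT 1 V X μ ν x := by
  simp only [covCurlT, covGradT_eq_smul η, smul_sub]

/-! ### §2.2 At the trivial background the covariant operators are the flat ones of `LatticeFieldCalculus` -/

/-- `D^η_{1,μ} = ∂_μ` with factor `η⁻¹` (`LatticeFieldCalculus.pdiff`). [cite: Balaban1985RegularSpaces, (1.1) p.76; Balaban1984PropagatorsI, (1.2) p.18] -/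
theorem covDerivFwdT_one (η : ℝ) (μ : Fin P.d) (G : Site P s → 𝔸) (x : Site P s) :
    covDerivFwdT η (fun _ : PBond P s => (1 : 𝔸ˣ)) μ G x = LatticeFieldCalculus.pdiff η⁻¹ μ G x := by
  simp [covDerivFwdT, LatticeFieldCalculus.pdiff, conjR_apply]

/-- `D^{η*}_{1,μ} = ∂*_μ` with factor `η⁻¹` (`LatticeFieldCalculus.pdiffAdj`). [cite: Balaban1985RegularSpaces, (1.1) p.76; Balaban1984PropagatorsI, (1.21) p.21] -/
theorem covDerivT_one (η : ℝ) (μ : Fin P.d) (G : Site P s → 𝔸) (x : Site P s) :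
    covDerivT η (fun _ : PBond P s => (1 : 𝔸ˣ)) μ G x = LatticeFieldCalculus.pdiffAdj η⁻¹ μ G x := by
  simp [covDerivT, LatticeFieldCalculus.pdiffAdj, conjR_apply]

/-- **`D^{η*}_1 X = ∂*X`**: at the trivial background the covariant divergence of a one-form is `LatticeFieldCalculus.diverg η⁻¹`.
[cite: Balaban1985RegularSpaces, (1.2) p.76; Balaban1984PropagatorsI, (1.21) p.21] -/
theorem covDivFormT_one (η : ℝ) (X : PBond P s → 𝔸) (x : Site P s) :
    covDivFormT η (fun _ : PBond P s => (1 : 𝔸ˣ)) X x = LatticeFieldCalculus.diverg η⁻¹ X x := by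
  simp [covDivFormT, covDerivT_one, LatticeFieldCalculus.diverg, LatticeFieldCalculus.pdiffAdj, formComp]

/-- **`D^η_1 X = ∂X`**: at the trivial background the covariant curl of a one-form is the plaquette variable `LatticeFieldCalculus.curl η⁻¹`.
[cite: Balaban1985RegularSpaces, (1.47) p.84; Balaban1984PropagatorsI, (1.2) p.18] -/
theorem covCurlT_one (η : ℝ) (X : PBond P s → 𝔸) (p : Plaq P s) :
    covCurlT η (fun _ : PBond P s => (1 : 𝔸ˣ)) X p.μ p.ν p.src = LatticeFieldCalculus.curl η⁻¹ X p := by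
  simp only [covCurlT, covGradT, covDerivFwdT_one, LatticeFieldCalculus.pdiff, LatticeFieldCalculus.curl, formComp, smul_sub]
  module

/-- **`Δ^η_1 X_ν = ΔX_ν`**: at the trivial background the covariant Laplacian is `LatticeFieldCalculus.laplace η⁻¹` on each component.
[cite: Balaban1985RegularSpaces, (1.39) p.83; Balaban1984PropagatorsI, (1.21) p.21] -/
theorem covLapFormT_one (η : ℝ) (X : PBond P s → 𝔸) (ν : Fin P.d) (x : Site P s) :
    covLapFormT η (fun _ : PBond P s => (1 : 𝔸ˣ)) X ν x = LatticeFieldCalculus.laplace η⁻¹ (formComp X ν) x := by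
  rw [LatticeFieldCalculus.laplace_apply]
  have h : ∀ μ : Fin P.d, covDerivFwdT η (fun _ : PBond P s => (1 : 𝔸ˣ)) μ (formComp X ν) =
      LatticeFieldCalculus.pdiff η⁻¹ μ (formComp X ν) := fun μ => funext (covDerivFwdT_one η μ (formComp X ν))
  simp [covLapFormT, covDerivT_one, h]

/-! ### §2.3 The operators annihilate the zero one-form (non-vacuity bookkeeping for (19)) -/

/-- `D^η_{U,μ}0 = 0`. [cite: Balaban1985RegularSpaces, (1.1) p.76] -/
theorem covDerivFwdT_zero (η : ℝ) (V : GaugeField P s 𝔸ˣ) (μ : Fin P.d) (x : Site P s) :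
    covDerivFwdT η V μ (fun _ => (0 : 𝔸)) x = 0 := by
  simp [covDerivFwdT, conjR_apply]

/-- `D^{η*}_{U,μ}0 = 0`. [cite: Balaban1985RegularSpaces, (1.1) p.76] -/
theorem covDerivT_zero (η : ℝ) (V : GaugeField P s 𝔸ˣ) (μ : Fin P.d) (x : Site P s) :
    covDerivT η V μ (fun _ => (0 : 𝔸)) x = 0 := by
  simp [covDerivT, conjR_apply]

/-- `∇^η_U 0 = 0`. [cite: Balaban1985Variational, (19) p.281] -/
theorem covGradT_zero (η : ℝ) (V : GaugeField P s 𝔸ˣ) (μ ν : Fin P.d) (x : Site P s) :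
    covGradT η V (fun _ => (0 : 𝔸)) μ ν x = 0 :=
  covDerivFwdT_zero η V μ x

/-- `D^{η*}_U D^η_U 0 = 0`. [cite: Balaban1985Variational, (19) p.281] -/
theorem covCodiffCurlT_zero (η : ℝ) (V : GaugeField P s 𝔸ˣ) (μ : Fin P.d) (x : Site P s) :
    covCodiffCurlT η V (fun _ => (0 : 𝔸)) μ x = 0 := by
  have h : covCurlT η V (fun _ => (0 : 𝔸)) = fun _ _ _ => 0 := by
    funext μ' ν' x'; simp [covCurlT, covGradT_zero]
  simp [covCodiffCurlT, h, covCodiffT, covDerivT_zero]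

/-- `Δ^η_U 0 = 0`. [cite: Balaban1985Variational, (19) p.281] -/
theorem covLapFormT_zero (η : ℝ) (V : GaugeField P s 𝔸ˣ) (ν : Fin P.d) (x : Site P s) :
    covLapFormT η V (fun _ => (0 : 𝔸)) ν x = 0 := by
  have h : ∀ μ : Fin P.d, covDerivFwdT η V μ (formComp (fun _ : PBond P s => (0 : 𝔸)) ν) = fun _ => 0 :=
    fun μ => funext fun x' => by simp [formComp, covDerivFwdT, conjR_apply]
  simp [covLapFormT, h, covDerivT_zero]

/-- `D^{η*}_U 0 = 0`. [cite: Balaban1985Variational, (21) p.281] -/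
theorem covDivFormT_zero (η : ℝ) (V : GaugeField P s 𝔸ˣ) (x : Site P s) :
    covDivFormT η V (fun _ => (0 : 𝔸)) x = 0 := by
  simp [covDivFormT, formComp, covDerivT, conjR_apply]

end Calculus

/-! ## §3 (14), (18), (19) at the T³ objects, with bodies -/

section Spaces

variable (F : T3Family) (n K : ℕ)

/-- The background read in the units of `M₂(ℂ)` (`SU(2) ≤ U(2) ≤ GL₂(ℂ)`, `B10Eq27TorusAxialLog.toUField`/`unitsField`) — the letters in which
`B10Eq68TorusRegularity.covDerivT` and `T3PrintedRegularMinimiser.DivSmall` read a configuration. [cite: Balaban1985Averaging, (19) p.21] -/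
def bgUnits (U₀ : GaugeField (F.P K) 0 (Matrix.specialUnitaryGroup (Fin 2) ℂ)) :
    GaugeField (F.P K) 0 (Matrix (Fin 2) (Fin 2) ℂ)ˣ :=
  unitsField (toUField U₀)

/-- **THE SECOND HALF OF (14) «|Ū₀ʲ − V| < C₁ε₁ on Λ_j, j = 0, 1, …, k»** at the T³ carrier (pure small-field problem: `Λ_j = ∅` for `j < k`,
`Λ_k` = the whole comparison lattice; the family's averaging `Ū₀ᵏ` = the (0.4)-descent `T3TiltDescent.descendTo`; `SU(2)` read in `M₂(ℂ)`,
operator norm): `‖Ū₀(c) − V(c)‖ < b` at every bond `c` of the comparison lattice. [cite: Balaban1985Variational, (14) p.280] -/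
def CloseAvg (h : n ≤ K) (b : ℝ) (V : GaugeField (F.P n) 0 (Matrix.specialUnitaryGroup (Fin 2) ℂ))
    (U₀ : GaugeField (F.P K) 0 (Matrix.specialUnitaryGroup (Fin 2) ℂ)) : Prop :=
  ∀ c : PBond (F.P n) 0,
    ‖((descendTo F ℰp n K h U₀ c : Matrix.specialUnitaryGroup (Fin 2) ℂ) : Matrix (Fin 2) (Fin 2) ℂ) -
      ((V c : Matrix.specialUnitaryGroup (Fin 2) ℂ) : Matrix (Fin 2) (Fin 2) ℂ)‖ < b

/-- **(14) «U₀ ∈ 𝔘_k({Ω_j}, C₁B₃ε₁), |Ū₀ʲ − V| < C₁ε₁ on Λ_j»** at the T³ carrier with its two radii displayed (`a` for the regular space, both clauses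
of (2) = `T3PrintedRegularMinimiser.RegPr`; `b` for the closeness of the averages) — the body of `B11.LGData.Sat14` below.  Print's p. 280 rider
«The additional regularity condition (3.35) in (1.33) is satisfied for U₀ also, because of the result of Sect. F [of [6]]» is a CONSEQUENCE print
draws ([Balaban1985RegularSpaces] Prop. 6), not a clause of (14), and is not a clause here. [cite: Balaban1985Variational, (14) p.280] -/
def Sat14T3 (h : n ≤ K) (a b : ℝ) (V : GaugeField (F.P n) 0 (Matrix.specialUnitaryGroup (Fin 2) ℂ))
    (U₀ : GaugeField (F.P K) 0 (Matrix.specialUnitaryGroup (Fin 2) ℂ)) : Prop :=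
  RegPr F n K a U₀ ∧ CloseAvg F n K h b V U₀

variable {F n K}

/-- A background IN the descent fibre of `V` (`Ū₀ = V`, the form in which the 19200 leaf `Prop7From14At` and (13) p. 280 supply the background)
satisfies the closeness half of (14) for every radius `b > 0`. [cite: Balaban1985Variational, (13)-(14) p.280] -/
theorem closeAvg_of_mem_fibre {h : n ≤ K} {b : ℝ} (hb : 0 < b) {V : GaugeField (F.P n) 0 (Matrix.specialUnitaryGroup (Fin 2) ℂ)}
    {U₀ : GaugeField (F.P K) 0 (Matrix.specialUnitaryGroup (Fin 2) ℂ)} (hU₀ : U₀ ∈ fibre F ℰp n K h V) :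
    CloseAvg F n K h b V U₀ := by
  intro c
  have hd : descendTo F ℰp n K h U₀ = V := hU₀
  rw [hd, sub_self, norm_zero]
  exact hb

/-- Hence (14) with radii `(a, b)`, `b > 0`, from `U₀ ∈ 𝔘_k(a) ∩ 𝔅_k(V)` — the background of (13): «U₀ ∈ 𝔘_k({Ω_j}, B₃L³ε₁) ∩ 𝔅_k(𝔅_k, V), (13)
… The configuration U₀ constructed above satisfies (14) with C₁ = L³». [cite: Balaban1985Variational, (13)-(14) p.280] -/
theorem sat14T3_of_mem_fibre {h : n ≤ K} {a b : ℝ} (hb : 0 < b) {V : GaugeField (F.P n) 0 (Matrix.specialUnitaryGroup (Fin 2) ℂ)}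
    {U₀ : GaugeField (F.P K) 0 (Matrix.specialUnitaryGroup (Fin 2) ℂ)} (hreg : RegPr F n K a U₀) (hU₀ : U₀ ∈ fibre F ℰp n K h V) :
    Sat14T3 F n K h a b V U₀ :=
  ⟨hreg, closeAvg_of_mem_fibre hb hU₀⟩

variable (F n K)

/-- **(19) AT THE T³ CARRIER, η-FREE FORM** — print: «U₁ = e^{iηA}, |A| < ε₂(Lʲη)⁻¹, |∇^η_{U₀}A| < ε₂(Lʲη)⁻², |D^{η*}_{U₀}D^η_{U₀}A|, |Δ^η_{U₀}A| <
ε₂(Lʲη)⁻³ on Ω_j, j = 0, 1, …, k, (19)».  Pure small-field problem: every `Ω_j` is the whole torus, so the binding member is `j = k = K − n`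
(`Lᵏη = 1`; it implies the members `j < k`, whose right sides carry the extra factor `L^{k−j} ≥ 1`).  Written for `X := ηA` (the exponent itself,
`𝔤 = su(2)`-valued: `X(b)` Hermitian and traceless, `U₁(b) = exp(iX(b))`) with the unit-spacing operators of §2 (`D^η = η⁻¹D¹`, §2.1), the four
bounds read `‖X‖ < ε₂η`, `‖∇¹_{U₀}X‖ < ε₂η²`, `‖D^{1*}_{U₀}D¹_{U₀}X‖, ‖Δ¹_{U₀}X‖ < ε₂η³`, `η = L^{−(K−n)}` — the same η-free convention as the
divergence clause `T3PrintedRegularMinimiser.DivSmall` of (2); operator norm on `M₂(ℂ)` ([Balaban1985Averaging] (19), the norm of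
[Balaban1985RegularSpaces]); the background enters through `bgUnits U₀`. [cite: Balaban1985Variational, (19) p.281] -/
def In19 (ε₂ : ℝ) (U₀ U₁ : GaugeField (F.P K) 0 (Matrix.specialUnitaryGroup (Fin 2) ℂ))
    (X : PBond (F.P K) 0 → Matrix (Fin 2) (Fin 2) ℂ) : Prop :=
  (∀ b : PBond (F.P K) 0, (X b).IsHermitian ∧ Matrix.trace (X b) = 0) ∧
  (∀ b : PBond (F.P K) 0, ((U₁ b : Matrix.specialUnitaryGroup (Fin 2) ℂ) : Matrix (Fin 2) (Fin 2) ℂ) = exp (Complex.I • X b)) ∧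
  (∀ b : PBond (F.P K) 0, ‖X b‖ < ε₂ * eta F n K) ∧
  (∀ (μ ν : Fin (F.P K).d) (x : Site (F.P K) 0), ‖covGradT 1 (bgUnits F K U₀) X μ ν x‖ < ε₂ * eta F n K ^ 2) ∧
  (∀ (μ : Fin (F.P K).d) (x : Site (F.P K) 0), ‖covCodiffCurlT 1 (bgUnits F K U₀) X μ x‖ < ε₂ * eta F n K ^ 3) ∧
  (∀ (ν : Fin (F.P K).d) (x : Site (F.P K) 0), ‖covLapFormT 1 (bgUnits F K U₀) X ν x‖ < ε₂ * eta F n K ^ 3)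

variable {F n K}

/-- The bond-variable member of (19) in the consumers' form: `‖X(b)‖ < ε₂L^{−(K−n)}` (the bond radius of the 19200 V3-F♭ files).
[cite: Balaban1985Variational, (19) p.281] -/
theorem In19.norm_lt {ε₂ : ℝ} {U₀ U₁ : GaugeField (F.P K) 0 (Matrix.specialUnitaryGroup (Fin 2) ℂ)}
    {X : PBond (F.P K) 0 → Matrix (Fin 2) (Fin 2) ℂ} (hX : In19 F n K ε₂ U₀ U₁ X) (b : PBond (F.P K) 0) :
    ‖X b‖ < ε₂ * ((F.L : ℝ)⁻¹) ^ (K - n) :=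
  hX.2.2.1 b

/-- The members `j < k` of (19) follow from the member `j = k` (their thresholds are larger by `L^{k−j} ≥ 1`; here for the bond variables, the
other three members alike). [cite: Balaban1985Variational, (19) p.281] -/
theorem In19.norm_lt_scale {ε₂ : ℝ} (hε₂ : 0 ≤ ε₂) {U₀ U₁ : GaugeField (F.P K) 0 (Matrix.specialUnitaryGroup (Fin 2) ℂ)}
    {X : PBond (F.P K) 0 → Matrix (Fin 2) (Fin 2) ℂ} (hX : In19 F n K ε₂ U₀ U₁ X) (b : PBond (F.P K) 0) (j : ℕ) :
    ‖X b‖ < ε₂ * eta F n K * (F.L : ℝ) ^ (K - n - j) := by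
  have h1 : (1 : ℝ) ≤ (F.L : ℝ) ^ (K - n - j) := one_le_pow₀ (by exact_mod_cast F.hL.2.le)
  have h0 : 0 ≤ ε₂ * eta F n K := mul_nonneg hε₂ (eta_pos F n K).le
  calc ‖X b‖ < ε₂ * eta F n K := hX.2.2.1 b
    _ = ε₂ * eta F n K * 1 := (mul_one _).symm
    _ ≤ ε₂ * eta F n K * (F.L : ℝ) ^ (K - n - j) := mul_le_mul_of_nonneg_left h1 h0

end Spaces

/-! ## §4 The operators of Sects. A–E that are NOT typed at the T³ objects: a declared residual layer

The following printed objects have no body on the torus carrier `Site (F.P K) 0` in the tree (they are typed on `ℤ^d` model carriers —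
`B8Eq119TwistedAxial.InAx`, `B7Eq84Concrete.uavg`, `B7Eq92Concrete.dbavgCovIter`, `B8Eq138LandauZd.IsLandau138W`, `B8Eq127LandauGauge` — or only
abstractly in `B11.LGData`): the axial gauge `Ax_k(𝔅_k, U₀)` of (18) ([Balaban1985RegularSpaces] (1.19)), the restriction (1.29) «\overline{R₀u}ʲ = 1 on
Λ_j» on gauge transformations (averages of `u`, [Balaban1985Averaging] (78)–(80) — NOT the group (4) «u(y) = 1 for y ∈ 𝔅_k»: [Balaban1985RegularSpaces]
p. 80 «These conditions are very hard to work with analytically and we have to replace them by conditions imposed on some averages of u»), the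
nonlinear averaged constraint (20) «Q_j(U₀, ηA) = B on Λ_j» (B by (1.31) of [6]; the chart's image is NOT in 𝔅_k(𝔅_k, V): [6] p. 81 «The set Σ_k is
not contained in 𝔅_k(𝔅_k, V) because the gauge transformations u do not satisfy the necessary conditions (1.14)»), the Landau condition (21)
«R(U₀)D^{η*}_{U₀}A = 0» (R(U₀) = the orthogonal projection onto Δ^η_{U₀}N(Q′(U₀)), [6] p. 80), the criticality of A(U₁U₀) «in the space defined by
(19)–(21)» (Prop. 2), and every letter of Sects. C–E ((43), (47), (55), (70), (77), (81), (104), (111), (112), (115)).  They are carried below as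
the fields of ONE structure over the T³ objects — a PRESENTATION parameter, never asserted, exactly as the corresponding fields of `B11.LGData` —
so that every theorem of §§5–8 holds for EVERY presentation and acquires its content when the presentation is instantiated by torus definitions
(owed; not in the tree at these objects). -/

section Residual

variable (F : T3Family) (n K : ℕ)

/-- **THE RESIDUAL LAYER OF SECTS. A–E AT THE T³ OBJECTS** (presentation parameter; docstring of `B11.LGData` for the printed meaning of each
field, same names): over backgrounds `U₀`, perturbations `U′`/`U₁`, gauge transformations `u` of run `K`'s finest lattice (`SU(2)`), data `V` on the
comparison lattice of height `n`, and `𝔤ᶜ`-valued one-forms `A′ : bonds → M₂(ℂ)`: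
* `IsAxial U₀ U` = «U ∈ Ax_k(𝔅_k, U₀)» (the third member of (18); [6] (1.19)/(1.34)) — binder
  `GaugeField (F.P K) 0 SU(2) → GaugeField (F.P K) 0 SU(2) → Prop` (background, FULL configuration `U = U′U₀`);
* `Restricted U₀ u` = «\overline{R₀u}ʲ = 1 on Λ_j, j = 0, …, k» ([6] (1.29); Prop. 2) — binder `GaugeField (F.P K) 0 SU(2) → GaugeTransf (F.P K) 0 SU(2) → Prop`;
* `AvgCond V U₀ X` = (20) = [6] (1.37) «Q_j(U₀, ηA) = B on Λ_j» for `X = ηA`, `B` given by `V`, `U₀` through (1.31) of [6] — binder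
  `GaugeField (F.P n) 0 SU(2) → GaugeField (F.P K) 0 SU(2) → (PBond (F.P K) 0 → M₂(ℂ)) → Prop`;
* `IsLandau U₀ X` = (21) = [6] (1.38) «R(U₀)D^{η*}_{U₀}A = 0» for `X = ηA` — binder `GaugeField (F.P K) 0 SU(2) → (PBond (F.P K) 0 → M₂(ℂ)) → Prop`;
* `CritL V U₀ U₁` = «U₁ is a critical configuration of the functional A(U₁U₀) in the space defined by (19)–(21)» (Prop. 2, Prop. 5) — binder
  `GaugeField (F.P n) 0 SU(2) → GaugeField (F.P K) 0 SU(2) → GaugeField (F.P K) 0 SU(2) → Prop` (datum, background, PERTURBATION `U₁`);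
* `In43 … SolAnalytic` = the Sect. C–E letters of `B11.LGData`, verbatim (same names, same arities; `Fld = PBond (F.P K) 0 → M₂(ℂ)`,
  `Cell = PBond (F.P n) 0`, `Site = Site (F.P n) 0`).
The [6]-side statement of record for `Ω_j = T_η` with BODIES for the first four (periodic-`ℤᵈ` reading of the torus, letters of
`B8Eq119TwistedAxial.InAx`/`Restr129`, `B7Prop4GeneralLevels.logCovIter`, `B8Eq138LandauZd.IsLandau138`) is `B8Thm2TorusAt.Thm2TorusAt` /
`Concl2T` (seat `lit-balaban-type-B8` gen 2, p465891; Thm 4: `B8Thm4TorusAt`); the identification of these fields with those bodies on the periodic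
pullback `B10Eq27TorusAxialLog.pull` is that seat's announced dictionary module, not this file.
[cite: Balaban1985Variational, (18)-(21) pp.280-281, Prop. 2 p.281, (43) p.285, (111)-(115) pp.294-295; Balaban1985RegularSpaces, (1.19) p.79, (1.29) p.81, (1.34)-(1.38) p.82] -/
structure Resid where
  IsAxial : GaugeField (F.P K) 0 (Matrix.specialUnitaryGroup (Fin 2) ℂ) → GaugeField (F.P K) 0 (Matrix.specialUnitaryGroup (Fin 2) ℂ) → Prop
  Restricted : GaugeField (F.P K) 0 (Matrix.specialUnitaryGroup (Fin 2) ℂ) → GaugeTransf (F.P K) 0 (Matrix.specialUnitaryGroup (Fin 2) ℂ) → Prop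
  AvgCond : GaugeField (F.P n) 0 (Matrix.specialUnitaryGroup (Fin 2) ℂ) → GaugeField (F.P K) 0 (Matrix.specialUnitaryGroup (Fin 2) ℂ) →
    (PBond (F.P K) 0 → Matrix (Fin 2) (Fin 2) ℂ) → Prop
  IsLandau : GaugeField (F.P K) 0 (Matrix.specialUnitaryGroup (Fin 2) ℂ) → (PBond (F.P K) 0 → Matrix (Fin 2) (Fin 2) ℂ) → Prop
  CritL : GaugeField (F.P n) 0 (Matrix.specialUnitaryGroup (Fin 2) ℂ) → GaugeField (F.P K) 0 (Matrix.specialUnitaryGroup (Fin 2) ℂ) →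
    GaugeField (F.P K) 0 (Matrix.specialUnitaryGroup (Fin 2) ℂ) → Prop
  In43 : GaugeField (F.P K) 0 (Matrix.specialUnitaryGroup (Fin 2) ℂ) → ℝ → (PBond (F.P K) 0 → Matrix (Fin 2) (Fin 2) ℂ) → Prop
  nM1 : GaugeField (F.P K) 0 (Matrix.specialUnitaryGroup (Fin 2) ℂ) → (PBond (F.P K) 0 → Matrix (Fin 2) (Fin 2) ℂ) → ℝ
  Def47 : GaugeField (F.P K) 0 (Matrix.specialUnitaryGroup (Fin 2) ℂ) → ℝ → Prop
  T47 : GaugeField (F.P K) 0 (Matrix.specialUnitaryGroup (Fin 2) ℂ) → (PBond (F.P K) 0 → Matrix (Fin 2) (Fin 2) ℂ) →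
    (PBond (F.P K) 0 → Matrix (Fin 2) (Fin 2) ℂ)
  normD : GaugeField (F.P K) 0 (Matrix.specialUnitaryGroup (Fin 2) ℂ) → (PBond (F.P K) 0 → Matrix (Fin 2) (Fin 2) ℂ) → ℝ
  kerD : GaugeField (F.P K) 0 (Matrix.specialUnitaryGroup (Fin 2) ℂ) → (PBond (F.P K) 0 → Matrix (Fin 2) (Fin 2) ℂ) →
    PBond (F.P n) 0 → Site (F.P n) 0 → ℝ
  nMax : GaugeField (F.P K) 0 (Matrix.specialUnitaryGroup (Fin 2) ℂ) → (PBond (F.P K) 0 → Matrix (Fin 2) (Fin 2) ℂ) → ℝ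
  dVn : GaugeField (F.P K) 0 (Matrix.specialUnitaryGroup (Fin 2) ℂ) → (PBond (F.P K) 0 → Matrix (Fin 2) (Fin 2) ℂ) → ℝ
  dVAnalytic : GaugeField (F.P K) 0 (Matrix.specialUnitaryGroup (Fin 2) ℂ) → ℝ → Prop
  Sol111 : GaugeField (F.P n) 0 (Matrix.specialUnitaryGroup (Fin 2) ℂ) → GaugeField (F.P K) 0 (Matrix.specialUnitaryGroup (Fin 2) ℂ) →
    (PBond (F.P K) 0 → Matrix (Fin 2) (Fin 2) ℂ) → Prop
  T112 : GaugeField (F.P n) 0 (Matrix.specialUnitaryGroup (Fin 2) ℂ) → GaugeField (F.P K) 0 (Matrix.specialUnitaryGroup (Fin 2) ℂ) →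
    (PBond (F.P K) 0 → Matrix (Fin 2) (Fin 2) ℂ) → GaugeField (F.P K) 0 (Matrix.specialUnitaryGroup (Fin 2) ℂ)
  LikeH1B : ℝ → GaugeField (F.P K) 0 (Matrix.specialUnitaryGroup (Fin 2) ℂ) → (PBond (F.P K) 0 → Matrix (Fin 2) (Fin 2) ℂ) → Prop
  Sol111G : GaugeField (F.P K) 0 (Matrix.specialUnitaryGroup (Fin 2) ℂ) → (PBond (F.P K) 0 → Matrix (Fin 2) (Fin 2) ℂ) →
    (PBond (F.P K) 0 → Matrix (Fin 2) (Fin 2) ℂ) → Prop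
  SolAnalytic : GaugeField (F.P K) 0 (Matrix.specialUnitaryGroup (Fin 2) ℂ) → ℝ → ℝ → Prop

end Residual

/-! ## §5 `B11.LGData` presented at the T³ objects, and the bridge to `T3Thm1Carrier.varProblem3` -/

section Presented

variable (F : T3Family) (n K : ℕ) (h : n ≤ K) (S : Resid F n K)

/-- **THE SECT. A–E CARRIER `B11.LGData` AT THE T³ OBJECTS** for the pure small-field problem of run `K` over the comparison height `n`
(presentation `S` for the untyped operators of §4).  WITH BODIES: `Cfg` = backgrounds `U₀` = `SU(2)` configurations of run `K`'s finest lattice;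
`Bdry` = data `V` on the comparison lattice; `Pert` = perturbations `U′`, `U₁` (again `SU(2)` configurations, (15)); `GT` = gauge transformations;
`Fld` = `M₂(ℂ)`-valued one-forms (`𝔤ᶜ`-valued vector fields `A′`); `Cell` = bonds `c` of the comparison lattice (the elements of `𝔅_k`, all of scale
`k = K − n`); `Site` = its points (`Λ_k`, scale `k`); `L`, `η = L^{−(K−n)}`, `d = 3`; `dist c y` = the lattice distance `|c₋ − y|` on the comparison
lattice (`Lᵏη = 1` units); `Sat14 a b V U₀` = (14) (`Sat14T3`); `In18 ε₀ V U₀ U′` = (18) «U′U₀ ∈ 𝔘_k({Ω_j}, ε₀) ∩ 𝔅_k(𝔅_k, V) ∩ Ax_k(𝔅_k, U₀)» =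
`U′U₀ ∈ T3PrintedRegularMinimiser.regFibrePr ε₀ V ∧ S.IsAxial U₀ (U′U₀)`; `Crit V U₀ U′` = «U′U₀ is a critical configuration of (5)» in
`T3Thm1Carrier`'s READING R2 (`T3Thm1CarrierNative.IsCritR2`: a minimiser over print's regular fibre (6)(e) for some `e > 0`); `In19_21 ε₂ V U₀ U₁`
= `∃ X, In19 ε₂ U₀ U₁ X ∧ S.AvgCond V U₀ X ∧ S.IsLandau U₀ X`; `toAxial U₀ U₁ u` = the `U′` with `U′U₀ = (U₁U₀)^u` ((16), `act16`).  FROM THE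
PRESENTATION: `CritL`, `Restricted` and the Sect. C–E fields. [cite: Balaban1985Variational, (14)-(21) pp.279-281] -/
def lgData3 : LGData where
  Cfg := GaugeField (F.P K) 0 (Matrix.specialUnitaryGroup (Fin 2) ℂ)
  Bdry := GaugeField (F.P n) 0 (Matrix.specialUnitaryGroup (Fin 2) ℂ)
  Pert := GaugeField (F.P K) 0 (Matrix.specialUnitaryGroup (Fin 2) ℂ)
  GT := GaugeTransf (F.P K) 0 (Matrix.specialUnitaryGroup (Fin 2) ℂ)
  Fld := PBond (F.P K) 0 → Matrix (Fin 2) (Fin 2) ℂ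
  Cell := PBond (F.P n) 0
  Site := Site (F.P n) 0
  L := F.L
  eta := eta F n K
  dim := 3
  scale := fun _ => K - n
  cscale := fun _ => K - n
  dist := fun c y => (Site.tdist c.src y : ℝ)
  Sat14 := fun a b V U₀ => Sat14T3 F n K h a b V U₀
  In18 := fun ε₀ V U₀ U' => emb15 U₀ U' ∈ regFibrePr F n K h ε₀ V ∧ S.IsAxial U₀ (emb15 U₀ U')
  Crit := fun V U₀ U' => IsCritR2 F n K h V (emb15 U₀ U')
  In19_21 := fun ε₂ V U₀ U₁ => ∃ X : PBond (F.P K) 0 → Matrix (Fin 2) (Fin 2) ℂ, In19 F n K ε₂ U₀ U₁ X ∧ S.AvgCond V U₀ X ∧ S.IsLandau U₀ X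
  CritL := S.CritL
  Restricted := S.Restricted
  toAxial := fun U₀ U₁ u => act16 U₀ u U₁
  In43 := S.In43
  nM1 := S.nM1
  Def47 := S.Def47
  T47 := S.T47
  normD := S.normD
  kerD := S.kerD
  nMax := S.nMax
  dVn := S.dVn
  dVAnalytic := S.dVAnalytic
  Sol111 := S.Sol111
  T112 := S.T112
  LikeH1B := S.LikeH1B
  Sol111G := S.Sol111G
  SolAnalytic := S.SolAnalytic

/-- **THE BRIDGE** `B11Prop7Assembly.Bridge` between Theorem 1's T³ carrier `T3Thm1Carrier.varProblem3` and its Sect. A–E presentation: the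
datum `V` is read identically on both sides; `emb U₀ U′ = U′U₀` is (15). [cite: Balaban1985Variational, (15) p.280] -/
def bridge3 : Bridge (varProblem3 F n K h) (lgData3 F n K h S) where
  bdry := fun V => V
  emb := fun U₀ U' => emb15 U₀ U'

variable {F n K h S}

/-- `Sat14` of the presented carrier IS (14) at the T³ objects (definitional). [cite: Balaban1985Variational, (14) p.280] -/
theorem lgData3_sat14_iff (a b : ℝ) (V : GaugeField (F.P n) 0 (Matrix.specialUnitaryGroup (Fin 2) ℂ))
    (U₀ : GaugeField (F.P K) 0 (Matrix.specialUnitaryGroup (Fin 2) ℂ)) :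
    (lgData3 F n K h S).Sat14 a b V U₀ ↔ RegPr F n K a U₀ ∧ CloseAvg F n K h b V U₀ := Iff.rfl

/-- `In18` of the presented carrier IS (18) at the T³ objects: `U′U₀ ∈ (6)(ε₀)` (print's regular fibre) and `U′U₀ ∈ Ax_k(𝔅_k, U₀)` (presented).
[cite: Balaban1985Variational, (18) p.280] -/
theorem lgData3_in18_iff (ε₀ : ℝ) (V : GaugeField (F.P n) 0 (Matrix.specialUnitaryGroup (Fin 2) ℂ))
    (U₀ U' : GaugeField (F.P K) 0 (Matrix.specialUnitaryGroup (Fin 2) ℂ)) :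
    (lgData3 F n K h S).In18 ε₀ V U₀ U' ↔ emb15 U₀ U' ∈ regFibrePr F n K h ε₀ V ∧ S.IsAxial U₀ (emb15 U₀ U') := Iff.rfl

/-- `Crit` of the presented carrier IS reading R2 of «U′U₀ is a critical configuration of (5)». [cite: Balaban1985Variational, Prop. 2 p.281] -/
theorem lgData3_crit_iff (V : GaugeField (F.P n) 0 (Matrix.specialUnitaryGroup (Fin 2) ℂ))
    (U₀ U' : GaugeField (F.P K) 0 (Matrix.specialUnitaryGroup (Fin 2) ℂ)) :
    (lgData3 F n K h S).Crit V U₀ U' ↔ IsCritR2 F n K h V (emb15 U₀ U') := Iff.rfl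

/-- `In19_21` of the presented carrier IS «U₁ satisfies (19)–(21)» at the T³ objects ((19) with body, (20)–(21) presented).
[cite: Balaban1985Variational, (19)-(21) p.281] -/
theorem lgData3_in19_21_iff (ε₂ : ℝ) (V : GaugeField (F.P n) 0 (Matrix.specialUnitaryGroup (Fin 2) ℂ))
    (U₀ U₁ : GaugeField (F.P K) 0 (Matrix.specialUnitaryGroup (Fin 2) ℂ)) :
    (lgData3 F n K h S).In19_21 ε₂ V U₀ U₁ ↔
      ∃ X : PBond (F.P K) 0 → Matrix (Fin 2) (Fin 2) ℂ, In19 F n K ε₂ U₀ U₁ X ∧ S.AvgCond V U₀ X ∧ S.IsLandau U₀ X := Iff.rfl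

/-- `emb U₀ (toAxial U₀ U₁ u) = (U₁U₀)^u` — p. 299 «Let us define U_k = (U₁U₀)^u» read through the bridge. [cite: Balaban1985Variational, (16) p.280, p.299 (before (141))] -/
theorem bridge3_emb_toAxial (U₀ U₁ : GaugeField (F.P K) 0 (Matrix.specialUnitaryGroup (Fin 2) ℂ))
    (u : GaugeTransf (F.P K) 0 (Matrix.specialUnitaryGroup (Fin 2) ℂ)) :
    (bridge3 F n K h S).emb U₀ ((lgData3 F n K h S).toAxial U₀ U₁ u) = GaugeField.gaugeAct u (emb15 U₀ U₁) :=
  emb15_act16 U₀ u U₁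

end Presented

/-! ## §6 The laws of the bridge at the T³ objects: the group (4) laws PROVED, the two located sentences presented -/

section Laws

variable (F : T3Family) {n K : ℕ} (h : n ≤ K)

/-- Restriction to the comparison lattice commutes with pointwise inversion (`u ↦ u⁻¹`). [cite: Balaban1985Averaging, (12)-(13) p.19] -/
theorem descTransf_inv {G : Type*} [GaugeGroup G] (u : GaugeTransf (F.P K) 0 G) :
    descTransf F n K h (fun x => (u x)⁻¹) = fun x => (descTransf F n K h u x)⁻¹ := by
  funext x
  unfold descTransf
  suffices hk : ∀ (k : ℕ) (y : Site (F.P K) k), T4Continuum.transfUp (fun x => (u x)⁻¹) k y = (T4Continuum.transfUp u k y)⁻¹ from hk _ _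
  intro k
  induction k with
  | zero => intro y; rfl
  | succ k ih => intro y; exact ih (emb y)

/-- Restriction to the comparison lattice commutes with pointwise products (`(vu)↓ = v↓u↓`). [cite: Balaban1985Averaging, (12)-(13) p.19] -/
theorem descTransf_mul {G : Type*} [GaugeGroup G] (v u : GaugeTransf (F.P K) 0 G) :
    descTransf F n K h (fun x => v x * u x) = fun x => descTransf F n K h v x * descTransf F n K h u x := by
  funext x
  unfold descTransf
  suffices hk : ∀ (k : ℕ) (y : Site (F.P K) k),
      T4Continuum.transfUp (fun x => v x * u x) k y = T4Continuum.transfUp v k y * T4Continuum.transfUp u k y from hk _ _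
  intro k
  induction k with
  | zero => intro y; rfl
  | succ k ih => intro y; exact ih (emb y)

/-- The trivial transformation restricts to the trivial one. [cite: Balaban1985Averaging, (12)-(13) p.19] -/
theorem descTransf_one {G : Type*} [GaugeGroup G] :
    descTransf F n K h (fun _ : Site (F.P K) 0 => (1 : G)) = fun _ => 1 := by
  funext x
  unfold descTransf
  suffices hk : ∀ (k : ℕ) (y : Site (F.P K) k), T4Continuum.transfUp (fun _ : Site (F.P K) 0 => (1 : G)) k y = 1 from hk _ _
  intro k
  induction k with
  | zero => intro y; rfl
  | succ k ih => intro y; exact ih (emb y)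

/-- The trivial gauge transformation acts trivially. [folklore] -/
private theorem gaugeAct_one_left {P : Params} {j : ℕ} {G : Type*} [GaugeGroup G] (U : GaugeField P j G) :
    GaugeField.gaugeAct (fun _ => (1 : G)) U = U := by
  funext b; simp [GaugeField.gaugeAct]

/-- **THE GROUP (4) «u(y) = 1 for y ∈ 𝔅_k»: «lie on one orbit» is reflexive.** [cite: Balaban1985Variational, (4) p.278] -/
theorem sameOrbit_refl (U : GaugeField (F.P K) 0 (Matrix.specialUnitaryGroup (Fin 2) ℂ)) : T3Thm1Carrier.SameOrbit F n K h U U :=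
  ⟨fun _ => 1, descTransf_one F h, (gaugeAct_one_left U).symm⟩

/-- **… symmetric** («These transformations form a group», p. 278: `u⁻¹` is trivial on `𝔅_k` when `u` is). [cite: Balaban1985Variational, (4) p.278] -/
theorem sameOrbit_symm {U U' : GaugeField (F.P K) 0 (Matrix.specialUnitaryGroup (Fin 2) ℂ)} (hUU' : T3Thm1Carrier.SameOrbit F n K h U U') :
    T3Thm1Carrier.SameOrbit F n K h U' U := by
  obtain ⟨u, hu, rfl⟩ := hUU'
  refine ⟨fun x => (u x)⁻¹, ?_, ?_⟩
  · rw [descTransf_inv, hu]; funext x; simp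
  · rw [gaugeAct_gaugeAct]
    funext b; simp [GaugeField.gaugeAct]

/-- **… and transitive** (`vu` is trivial on `𝔅_k` when `u`, `v` are). [cite: Balaban1985Variational, (4) p.278] -/
theorem sameOrbit_trans {U U' U'' : GaugeField (F.P K) 0 (Matrix.specialUnitaryGroup (Fin 2) ℂ)}
    (h₁ : T3Thm1Carrier.SameOrbit F n K h U U') (h₂ : T3Thm1Carrier.SameOrbit F n K h U' U'') : T3Thm1Carrier.SameOrbit F n K h U U'' := by
  obtain ⟨u, hu, rfl⟩ := h₁
  obtain ⟨v, hv, rfl⟩ := h₂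
  refine ⟨fun x => v x * u x, ?_, (gaugeAct_gaugeAct v u U)⟩
  rw [descTransf_mul, hu, hv]; funext x; simp

/-- The radius of a non-empty regular space is positive: `U ∈ 𝔘_k(ε₀) ⇒ ε₀ > 0` (the plaquette clause at any plaquette; `d = 3 ≥ 2`).
[cite: Balaban1985Variational, (2) p.278] -/
theorem pos_of_regPr {ε₀ : ℝ} {U : GaugeField (F.P K) 0 (Matrix.specialUnitaryGroup (Fin 2) ℂ)} (hU : RegPr F n K ε₀ U) : 0 < ε₀ := by
  let μ : Fin (F.P K).d := ⟨0, by simp⟩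
  let ν : Fin (F.P K).d := ⟨1, by simp⟩
  have hμν : μ < ν := Fin.mk_lt_mk.mpr zero_lt_one
  have hp := hU.plaqSmall ⟨default, μ, ν, hμν⟩
  have hc : (0 : ℝ) < ((F.L : ℝ)⁻¹) ^ (2 * (K - n)) := pow_pos (inv_pos.mpr (L_cast_pos F)) _
  have h0 : (0 : ℝ) ≤ dist1 (GaugeField.plaqHol U ⟨default, μ, ν, hμν⟩) := GaugeGroup.dist1_nonneg _
  have hprod : 0 < ε₀ * ((F.L : ℝ)⁻¹) ^ (2 * (K - n)) := h0.trans_lt hp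
  exact (mul_pos_iff_of_pos_right hc).mp hprod

/-- **READING R2 IS CONSTANT ON (4)-ORBITS**: a minimiser over print's regular fibre (6)(e) stays one after a gauge transformation trivial on
`𝔅_k` ((6)(e) is invariant — `T3PrintedRegularOrbits.gaugeAct_mem_regFibrePr_iff_of_trivial` — and `A(U^u) = A(U)`); this is p. 280 «The
functional (5) is gauge invariant, hence it is enough to consider it on the space (18)» for the criticality reading of the carrier.
[cite: Balaban1985Variational, p.280 (sentence before (18)), (4)-(6) p.278] -/
theorem isCritR2_gaugeAct_of_trivial {u : GaugeTransf (F.P K) 0 (Matrix.specialUnitaryGroup (Fin 2) ℂ)}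
    (hu : descTransf F n K h u = fun _ => 1) {V : GaugeField (F.P n) 0 (Matrix.specialUnitaryGroup (Fin 2) ℂ)}
    {U : GaugeField (F.P K) 0 (Matrix.specialUnitaryGroup (Fin 2) ℂ)} (hc : IsCritR2 F n K h V U) :
    IsCritR2 F n K h V (GaugeField.gaugeAct u U) := by
  obtain ⟨e, he, hUe, hmin⟩ := hc
  refine ⟨e, he, (gaugeAct_mem_regFibrePr_iff_of_trivial F h he.le hu U V).mpr hUe, fun W hW => ?_⟩
  show wilsonAction4 (GaugeField.gaugeAct u U) ≤ wilsonAction4 W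
  rw [show wilsonAction4 (GaugeField.gaugeAct u U) = wilsonAction4 U from T4WilsonGaugeFlatDirection.wilsonAction_gaugeAct 1 u U]
  exact hmin hW

variable (n K)

/-- **THE LOCATED SENTENCE OF P. 280 AT THE T³ OBJECTS** (presented, never asserted): «Now we choose a gauge in the space (6). Using the
transformations (16) with u satisfying (4) we fix the axial gauge conditions Ax_k(𝔅_k, U₀)» — resting on [Balaban1985RegularSpaces] p. 79 «The
conditions (1.19) determine uniquely an element in each orbit given by the subgroup (1.14)» (existence half): every configuration has a
(4)-gauge image in `Ax_k(𝔅_k, U₀)` for every background `U₀`.  A law ON THE PRESENTATION `S.IsAxial`. [cite: Balaban1985Variational, p.280 (sentence before (18)); Balaban1985RegularSpaces, p.79 (sentence after (1.20))] -/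
def AxialRepr (S : Resid F n K) : Prop :=
  ∀ U₀ U : GaugeField (F.P K) 0 (Matrix.specialUnitaryGroup (Fin 2) ℂ),
    ∃ v : GaugeTransf (F.P K) 0 (Matrix.specialUnitaryGroup (Fin 2) ℂ), descTransf F n K h v = (fun _ => 1) ∧ S.IsAxial U₀ (GaugeField.gaugeAct v U)

/-- **THE LOCATED LAW `orbit16` OF `B11Prop7Assembly.Bridge.Laws` AT THE T³ OBJECTS** (presented, never asserted; print: p. 281 «The above mapping
is one-to-one» + Prop. 2 «transforming them to the axial gauge Ax_k(𝔅_k, U₀) by gauge transformations u satisfying the conditions \overline{R₀u}ʲ =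
1 on Λ_j»): the images `(U₁U₀)^u`, `(U₁U₀)^{u′}` of ONE configuration under two `S.Restricted` gauge transformations lie on one orbit of the group
(4).  HONEST: as a law over all `U₁, u, u′` this is the LQB lane's reading of the injectivity sentence, stronger than print (which concerns the
axial images of configurations in (18)); it is a law ON THE PRESENTATION `S.Restricted`, not a theorem. [cite: Balaban1985Variational, Prop. 2 p.281, p.281 («The above mapping is one-to-one»)] -/
def Orbit16 (S : Resid F n K) : Prop :=
  ∀ (U₀ U₁ : GaugeField (F.P K) 0 (Matrix.specialUnitaryGroup (Fin 2) ℂ)) (u u' : GaugeTransf (F.P K) 0 (Matrix.specialUnitaryGroup (Fin 2) ℂ)),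
    S.Restricted U₀ u → S.Restricted U₀ u' →
      T3Thm1Carrier.SameOrbit F n K h (GaugeField.gaugeAct u (emb15 U₀ U₁)) (GaugeField.gaugeAct u' (emb15 U₀ U₁))

variable {n K} {S : Resid F n K}

/-- **THE BRIDGE LAWS AT THE T³ OBJECTS**: `symm`/`trans` are THEOREMS (the group (4)); `gaugeFix` follows from the presented axial-gauge
sentence `AxialRepr` — the (4)-image stays in (6)(ε₀) (`T3PrintedRegularOrbits`, [7] p. 278 «the space (6) is a union of orbits of this group»)
and stays critical in reading R2 (`isCritR2_gaugeAct_of_trivial`); `orbit16` is the presented located law `Orbit16`.  For every `C₁, B₃`.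
[cite: Balaban1985Variational, (4) p.278, (15)-(18) p.280, Prop. 2 p.281] -/
theorem bridge3_laws (hax : AxialRepr F n K h S) (h16 : Orbit16 F n K h S) (C₁ B₃ : ℝ) : (bridge3 F n K h S).Laws C₁ B₃ where
  gaugeFix := by
    intro ε₀ ε₁ V U₀ U _h14 hU hB
    obtain ⟨v, hv, hax'⟩ := hax U₀ U
    have hε₀ : 0 < ε₀ := pos_of_regPr F hU
    have hmem : U ∈ regFibrePr F n K h ε₀ V := (mem_regFibrePr_iff F).mpr ⟨hB, hU⟩
    have hmem' : GaugeField.gaugeAct v U ∈ regFibrePr F n K h ε₀ V :=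
      (gaugeAct_mem_regFibrePr_iff_of_trivial F h hε₀.le hv U V).mpr hmem
    refine ⟨pert U₀ (GaugeField.gaugeAct v U), ?_, ?_, ?_⟩
    · show emb15 U₀ (pert U₀ (GaugeField.gaugeAct v U)) ∈ regFibrePr F n K h ε₀ V ∧
        S.IsAxial U₀ (emb15 U₀ (pert U₀ (GaugeField.gaugeAct v U)))
      rw [emb15_pert]
      exact ⟨hmem', hax'⟩
    · show T3Thm1Carrier.SameOrbit F n K h U (emb15 U₀ (pert U₀ (GaugeField.gaugeAct v U)))
      rw [emb15_pert]
      exact ⟨v, hv, rfl⟩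
    · intro hcrit
      show IsCritR2 F n K h V (emb15 U₀ (pert U₀ (GaugeField.gaugeAct v U)))
      rw [emb15_pert]
      exact isCritR2_gaugeAct_of_trivial F h hv hcrit
  orbit16 := by
    intro U₀ U₁ u u' hu hu'
    show T3Thm1Carrier.SameOrbit F n K h (emb15 U₀ (act16 U₀ u U₁)) (emb15 U₀ (act16 U₀ u' U₁))
    rw [emb15_act16, emb15_act16]
    exact h16 U₀ U₁ u u' hu hu'
  symm := fun _ _ hUU' => sameOrbit_symm F h hUU'
  trans := fun _ _ _ h₁ h₂ => sameOrbit_trans F h h₁ h₂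

end Laws

/-! ## §7 Proposition 2 = the gauge chart of [Balaban1985RegularSpaces] Thm 2 as used in Sect. A, READ AT THE T³ CARRIER, NATIVE FORM -/

section Prop2

/-- A presentation of the residual layer for EVERY member of the family of carriers with block size `L` (`T3Thm1Carrier.Idx L`: members `F`
with `F.L = L`, heights `n < K`). [cite: Balaban1985Variational, Thm 1 p.279 («The constants … depend on d and L only»)] -/
def ResidFam (L : ℕ) : Type _ := (i : Idx L) → Resid i.1.1 i.1.2.1 i.1.2.2

/-- The family of presented Sect. A–E carriers over `Idx L`. [cite: Balaban1985Variational, (14)-(21) pp.279-281] -/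
def famLG3 (L : ℕ) (S : ResidFam L) : Idx L → LGData := fun i => lgData3 i.1.1 i.1.2.1 i.1.2.2 i.2.2.le (S i)

/-- The family of bridges `famX L i ⇄ famLG3 L S i`. [cite: Balaban1985Variational, (15) p.280] -/
def bridgeFam3 (L : ℕ) (S : ResidFam L) (i : Idx L) : Bridge (famX L i) (famLG3 L S i) :=
  bridge3 i.1.1 i.1.2.1 i.1.2.2 i.2.2.le (S i)

/-- **[Balaban1985Variational] PROPOSITION 2 — THE LANDAU-GAUGE CHART OF [Balaban1985RegularSpaces] THEOREM 2 AROUND A BACKGROUND (14) — READ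
AT THE T³ CARRIER, NATIVE FORM** (hypothesis schema, never asserted; the statement the 19200 leaf-V3 provers asked for as `GaugeChartT3At`).
Print, p. 280–281: «Configurations U from the space (18), and U₀, satisfy the assumptions (1.33)–(1.35) of this theorem with α₀ = ε₀, α₁ = C₁ε₁.
… Thus for ε₀, ε₁ sufficiently small, more exactly for ε₀ + C₁ε₁ ≦ c₁, and for an arbitrary configuration U = U′U₀ from (18) there exists exactly
one gauge transformation u satisfying \overline{R₀u}ʲ = 1 on Λ_j, j = 0, 1, …, k (thus u = 1 on Λ₀), such that U₁ = U′^{u⁻¹} satisfies the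
conditions (1.36)–(1.39) of [6]. These gauge transformations define a mapping of the space (18) into a space of gauge field configurations U₁U₀
with U₁ satisfying the conditions (19)–(21) with ε₂ ≧ B₁(ε₀ + C₁ε₁). … Proposition 2. All critical orbits of the functional (5) in the space (6),
or all critical configurations of this functional in the space (18), can be obtained by taking critical configurations U₁ of the functional A(U₁U₀)
in the space defined by (19)–(21), where U₀ satisfies (14), and transforming them to the axial gauge Ax_k(𝔅_k, U₀) by gauge transformations u
satisfying the conditions \overline{R₀u}ʲ = 1 on Λ_j».  AT THE CARRIER (member `F`, `n < K`, `S` the presentation of §4): for `0 < ε₀, ε₁`,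
`ε₀ + C₁ε₁ ≦ c₁`, `B₁(ε₀ + C₁ε₁) ≦ ε₂`, every datum `V`, every background `U₀ ∈ 𝔘_k(C₁B₃ε₁)` with `‖Ū₀ − V‖ < C₁ε₁` (14), and every `U` in
print's regular fibre (6)(ε₀) of `V` which is in the axial gauge relative to `U₀` and critical in reading R2, there are a gauge transformation `u`
with the restriction (1.29), a perturbation `U₁` and an exponent `X = ηA` with `(U₁U₀)^u = U`, (19) (`In19`), (20), (21), and «U₁ critical in the
space (19)–(21)».  HONEST: `u` is NOT asserted to lie in the group (4) and `U₁U₀` is NOT asserted to lie in the fibre of `V` (it satisfies (20)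
instead) — [6] pp. 80–81; the constants `B₁, c₁` are [6] Thm 2's (`B8.Thm2Printed`), `B₃` the constant (162), `C₁` as in (14) (`C₁ = L³` for the
background of (13)); the uniqueness of `u` («exactly one») is not part of `B11.Prop2Printed` and not displayed here. [cite: Balaban1985Variational, Prop. 2 p.281, (18)-(21) pp.280-281; Balaban1985RegularSpaces, Thm 2 p.83] -/
def Prop2NativeAt (L : ℕ) (S : ResidFam L) (B₁ B₃ C₁ c₁ : ℝ) : Prop :=
  ∀ F : T3Family, ∀ hF : F.L = L, ∀ (n K : ℕ) (hnK : n < K) (ε₀ ε₁ ε₂ : ℝ), 0 < ε₀ → 0 < ε₁ → ε₀ + C₁ * ε₁ ≤ c₁ → B₁ * (ε₀ + C₁ * ε₁) ≤ ε₂ →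
    ∀ (V : GaugeField (F.P n) 0 (Matrix.specialUnitaryGroup (Fin 2) ℂ)) (U₀ : GaugeField (F.P K) 0 (Matrix.specialUnitaryGroup (Fin 2) ℂ)),
      RegPr F n K (C₁ * B₃ * ε₁) U₀ → CloseAvg F n K hnK.le (C₁ * ε₁) V U₀ →
        ∀ U : GaugeField (F.P K) 0 (Matrix.specialUnitaryGroup (Fin 2) ℂ),
          U ∈ regFibrePr F n K hnK.le ε₀ V → (S ⟨(F, n, K), hF, hnK⟩).IsAxial U₀ U → IsCritR2 F n K hnK.le V U →
            ∃ (u : GaugeTransf (F.P K) 0 (Matrix.specialUnitaryGroup (Fin 2) ℂ))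
              (U₁ : GaugeField (F.P K) 0 (Matrix.specialUnitaryGroup (Fin 2) ℂ)) (X : PBond (F.P K) 0 → Matrix (Fin 2) (Fin 2) ℂ),
              (S ⟨(F, n, K), hF, hnK⟩).Restricted U₀ u ∧ GaugeField.gaugeAct u (emb15 U₀ U₁) = U ∧
                In19 F n K ε₂ U₀ U₁ X ∧ (S ⟨(F, n, K), hF, hnK⟩).AvgCond V U₀ X ∧ (S ⟨(F, n, K), hF, hnK⟩).IsLandau U₀ X ∧
                (S ⟨(F, n, K), hF, hnK⟩).CritL V U₀ U₁

/-- **`B11.Prop2Printed` AT THE PRESENTED FAMILY IS THE NATIVE CHART STATEMENT** (pure unfolding of the carrier, member by member; the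
perturbation `U′` of (18) and the configuration `U = U′U₀` correspond through (15), `toAxial U₀ U₁ u = U′` ⟺ `(U₁U₀)^u = U` through (16)).
[cite: Balaban1985Variational, Prop. 2 p.281, (15)-(16) p.280] -/
theorem prop2Printed_famLG3_iff_native {L : ℕ} {S : ResidFam L} {B₁ B₃ C₁ c₁ : ℝ} :
    Prop2Printed B₁ B₃ C₁ c₁ (famLG3 L S) ↔ Prop2NativeAt L S B₁ B₃ C₁ c₁ := by
  constructor
  · intro H F hF n K hnK ε₀ ε₁ ε₂ hε₀ hε₁ hsum hε₂ V U₀ hreg hclose U hU hax hcrit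
    have H' := H ⟨(F, n, K), hF, hnK⟩ ε₀ ε₁ ε₂ hε₀ hε₁ hsum hε₂ V U₀ ⟨hreg, hclose⟩ (pert U₀ U)
      (by show emb15 U₀ (pert U₀ U) ∈ regFibrePr F n K hnK.le ε₀ V ∧ (S ⟨(F, n, K), hF, hnK⟩).IsAxial U₀ (emb15 U₀ (pert U₀ U))
          rw [emb15_pert]; exact ⟨hU, hax⟩)
      (by show IsCritR2 F n K hnK.le V (emb15 U₀ (pert U₀ U)); rw [emb15_pert]; exact hcrit)
    obtain ⟨u, U₁, hu, ⟨X, h19, h20, h21⟩, hcL, hax16⟩ := H'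
    refine ⟨u, U₁, X, hu, ?_, h19, h20, h21, hcL⟩
    have e := congrArg (emb15 U₀) hax16
    change emb15 U₀ (act16 U₀ u U₁) = emb15 U₀ (pert U₀ U) at e
    rwa [emb15_act16, emb15_pert] at e
  · intro H i ε₀ ε₁ ε₂ hε₀ hε₁ hsum hε₂ V U₀ h14 U' h18 hcrit
    obtain ⟨⟨F, n, K⟩, hF, hnK⟩ := i
    obtain ⟨hreg, hclose⟩ := h14
    obtain ⟨hU, hax⟩ := h18
    obtain ⟨u, U₁, X, hu, hact, h19, h20, h21, hcL⟩ :=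
      H F hF n K hnK ε₀ ε₁ ε₂ hε₀ hε₁ hsum hε₂ V U₀ hreg hclose (emb15 U₀ U') hU hax hcrit
    refine ⟨u, U₁, hu, ⟨X, h19, h20, h21⟩, hcL, ?_⟩
    show act16 U₀ u U₁ = U'
    rw [act16_eq, hact, pert_emb15]

end Prop2

/-! ## §8 THE KNIT: the 19200 leaf V3 `Prop7From14At L B₃` from Propositions 2, 5, 6 and the located leaves AT THE T³ OBJECTS, by name -/

section Knit

variable {I : Type}

/-- `B11Prop7Assembly.exists_minimalOrbit_of_prop6_cap` with the constant «O(1)» DISPLAYED as `O₂·O₁` (the LQB theorem hides it behind `∃ O > 0`;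
the 19200 leaf needs `O(1) ≧ 1`).  Verbatim re-run of the LQB proof: Prop. 6 at `ε₄ = a₄` («if 2B₀C₁B₃ε₁ ≦ a₄»), `crit112`, `axial18`, `minimal142`
under the cap `O₂O₁C₁B₃ε₁ ≦ e₅`; `a′₁ = min{a₄/(2B₀C₁B₃), e₅/(O₂O₁C₁B₃)}`. [cite: Balaban1985Variational, Prop. 7 p.299; p.296 after (122); p.299 before (141)] -/
theorem exists_minimalOrbit_of_prop6_cap_explicit {famP : I → VarProblemX} {famD : I → LGData}
    (β : ∀ i, Bridge (famP i) (famD i)) {B₀ B₃ C₁ O₁ O₂ e₅ : ℝ} (leaves : ∀ i, ExistenceLeavesCap (β i) B₀ B₃ C₁ O₁ O₂ e₅)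
    (hB₀ : 0 < B₀) (hB₃ : 0 < B₃) (hC₁ : 0 < C₁) (hO₁ : 0 < O₁) (hO₂ : 0 < O₂) (he₅ : 0 < e₅)
    (h6 : Prop6Printed B₀ B₃ C₁ famD) :
    ∃ a₁' : ℝ, 0 < a₁' ∧ ∀ i : I, ∀ ε₁ : ℝ, 0 < ε₁ → ε₁ ≤ a₁' →
      ∀ (V : (famP i).Bdry) (U₀ : (famD i).Cfg), (famD i).Sat14 (C₁ * B₃ * ε₁) (C₁ * ε₁) ((β i).bdry V) U₀ →
        ∃ U : (famP i).Cfg, (famP i).OnMinimalOrbit (O₂ * O₁ * C₁ * B₃ * ε₁) V U := by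
  obtain ⟨a₄, ha₄, H6⟩ := h6
  have hK : 0 < 2 * B₀ * C₁ * B₃ := by positivity
  have hK' : 0 < O₂ * O₁ * C₁ * B₃ := by positivity
  refine ⟨min (a₄ / (2 * B₀ * C₁ * B₃)) (e₅ / (O₂ * O₁ * C₁ * B₃)), lt_min (div_pos ha₄ hK) (div_pos he₅ hK'), ?_⟩
  intro i ε₁ hε₁ hε₁a V U₀ h14
  have h2B : 2 * B₀ * C₁ * B₃ * ε₁ ≤ a₄ := by
    have := (le_div_iff₀ hK).1 (hε₁a.trans (min_le_left _ _))
    linarith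
  have hcap : O₂ * (O₁ * C₁ * B₃ * ε₁) ≤ e₅ := by
    have := (le_div_iff₀ hK').1 (hε₁a.trans (min_le_right _ _))
    linarith
  obtain ⟨⟨A₁, _, hsol, hA₁, _⟩, _, _⟩ := H6 i ε₁ a₄ hε₁ le_rfl h2B ((β i).bdry V) U₀ h14
  obtain ⟨hcritL, h19⟩ := (leaves i).crit112 ε₁ V U₀ A₁ hε₁ h14 hsol hA₁
  obtain ⟨u, hu, hInU, hInB, hcrit⟩ :=
    (leaves i).axial18 ε₁ (O₁ * C₁ * B₃ * ε₁) V U₀ ((famD i).T112 ((β i).bdry V) U₀ A₁) h14 h19 hcritL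
  have hmin := (leaves i).minimal142 (O₂ * (O₁ * C₁ * B₃ * ε₁)) ε₁ V U₀ ((famD i).T112 ((β i).bdry V) U₀ A₁) u
    hcap h14 hcritL hu hInU hInB hcrit
  have hO : O₂ * O₁ * C₁ * B₃ * ε₁ = O₂ * (O₁ * C₁ * B₃ * ε₁) := by ring
  rw [hO]
  exact ⟨_, hmin⟩

/-- **THE 19200 LEAF V3 FROM PROPOSITIONS 2, 5, 6 AT THE T³ OBJECTS, BY NAME** (`B11Prop7Assembly.atMostOneCriticalOrbit_of_props` +
`exists_minimalOrbit_of_prop6_cap_explicit` over the presented family, `C₁ = L³`): for a block size `L > 1`, a presentation `S` of the residual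
layer for every member, the bridge laws (`bridge3_laws`: the group (4) proved, the axial sentence and the injectivity law presented) and the
capped existence leaves of pp. 296–299 (`B11Prop7Assembly.ExistenceLeavesCap`), IF `B11.Prop2Printed`, `B11.Prop5Printed`, `B11.Prop6Printed` hold
for the presented family (constants `B₀, B₁ > 0`, `B₃ ≧ 1`, `B₀ ≦ 4B₁`, `c₁ > 0`, leaf constants `O₁, O₂ ≧ 1`, cap `e₅ > 0`), THEN
`T3Thm1CarrierNative.Prop7From14At L B₃` — literally the hypothesis `H7` of the ym3 composition `Summit…Variational.thm1At_fam_of_prop7_prop8_sectF`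
(the background of `H7`, `U₀ ∈ 𝔘_k(L³B₃ε₁) ∩ 𝔅_k(V)`, meets (14) with `C₁ = L³`: `sat14T3_of_mem_fibre`). [cite: Balaban1985Variational, Prop. 7 p.299, Prop. 2 p.281, Props 5-6 pp.294-295, (122) p.296] -/
theorem prop7From14At_of_props {L : ℕ} (hL : 1 < L) (S : ResidFam L) {B₀ B₁ B₃ c₁ O₁ O₂ e₅ : ℝ}
    (laws : ∀ i : Idx L, (bridgeFam3 L S i).Laws ((L : ℝ) ^ 3) B₃)
    (leaves : ∀ i : Idx L, ExistenceLeavesCap (bridgeFam3 L S i) B₀ B₃ ((L : ℝ) ^ 3) O₁ O₂ e₅)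
    (hB₀ : 0 < B₀) (hB₁ : 0 < B₁) (hB₃ : 1 ≤ B₃) (hB₀B₁ : B₀ ≤ 4 * B₁) (hc₁ : 0 < c₁) (hO₁ : 1 ≤ O₁) (hO₂ : 1 ≤ O₂) (he₅ : 0 < e₅)
    (h2 : Prop2Printed B₁ B₃ ((L : ℝ) ^ 3) c₁ (famLG3 L S)) (h5 : Prop5Printed B₁ B₃ ((L : ℝ) ^ 3) (famLG3 L S))
    (h6 : Prop6Printed B₀ B₃ ((L : ℝ) ^ 3) (famLG3 L S)) :
    Prop7From14At L B₃ := by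
  have hL1 : (1 : ℝ) ≤ (L : ℝ) := by exact_mod_cast hL.le
  have hC₁ : (1 : ℝ) ≤ (L : ℝ) ^ 3 := one_le_pow₀ hL1
  have hC₁pos : (0 : ℝ) < (L : ℝ) ^ 3 := by positivity
  obtain ⟨a₀, ha₀, HU⟩ := atMostOneCriticalOrbit_of_props (bridgeFam3 L S) laws hB₁ hB₃ hC₁ hB₀B₁ hc₁ h2 h5 h6
  obtain ⟨a₁', ha₁', HE⟩ := exists_minimalOrbit_of_prop6_cap_explicit (bridgeFam3 L S) leaves hB₀ (by linarith) hC₁pos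
    (by linarith) (by linarith) he₅ h6
  refine ⟨a₀, a₁', O₂ * O₁, ha₀, ha₁', one_le_mul_of_one_le_of_one_le hO₂ hO₁, ?_⟩
  intro i ε₀ ε₁ hε₁ V _hV U₀ hU₀ hB
  -- the background of (13)/(14): `U₀ ∈ 𝔘_k(L³B₃ε₁) ∩ 𝔅_k(V)` gives `Sat14 (C₁B₃ε₁) (C₁ε₁)` with `C₁ = L³`
  have h14 : (famLG3 L S i).Sat14 ((L : ℝ) ^ 3 * B₃ * ε₁) ((L : ℝ) ^ 3 * ε₁) ((bridgeFam3 L S i).bdry V) U₀ := by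
    obtain ⟨⟨F, n, K⟩, hF, hnK⟩ := i
    exact sat14T3_of_mem_fibre (mul_pos hC₁pos hε₁) hU₀ hB
  refine ⟨fun hε₀a hB₃ε => HU i ε₀ ε₁ hε₁ hε₀a hB₃ε V U₀ h14, fun hε₁a => ?_⟩
  obtain ⟨U, hU⟩ := HE i ε₁ hε₁ hε₁a V U₀ h14
  exact ⟨U, hU⟩

/-- The same with the bridge laws supplied from the two presented sentences of §6 (`AxialRepr`, `Orbit16`) — everything else of the laws being
theorems. [cite: Balaban1985Variational, Prop. 7 p.299, p.280 (sentence before (18)), p.281 («The above mapping is one-to-one»)] -/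
theorem prop7From14At_of_props_of_located {L : ℕ} (hL : 1 < L) (S : ResidFam L) {B₀ B₁ B₃ c₁ O₁ O₂ e₅ : ℝ}
    (hax : ∀ i : Idx L, AxialRepr i.1.1 i.1.2.1 i.1.2.2 i.2.2.le (S i))
    (h16 : ∀ i : Idx L, Orbit16 i.1.1 i.1.2.1 i.1.2.2 i.2.2.le (S i))
    (leaves : ∀ i : Idx L, ExistenceLeavesCap (bridgeFam3 L S i) B₀ B₃ ((L : ℝ) ^ 3) O₁ O₂ e₅)
    (hB₀ : 0 < B₀) (hB₁ : 0 < B₁) (hB₃ : 1 ≤ B₃) (hB₀B₁ : B₀ ≤ 4 * B₁) (hc₁ : 0 < c₁) (hO₁ : 1 ≤ O₁) (hO₂ : 1 ≤ O₂) (he₅ : 0 < e₅)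
    (h2 : Prop2Printed B₁ B₃ ((L : ℝ) ^ 3) c₁ (famLG3 L S)) (h5 : Prop5Printed B₁ B₃ ((L : ℝ) ^ 3) (famLG3 L S))
    (h6 : Prop6Printed B₀ B₃ ((L : ℝ) ^ 3) (famLG3 L S)) :
    Prop7From14At L B₃ :=
  prop7From14At_of_props hL S (fun i => bridge3_laws i.1.1 i.2.2.le (hax i) (h16 i) _ _) leaves hB₀ hB₁ hB₃ hB₀B₁ hc₁ hO₁ hO₂ he₅ h2 h5 h6

end Knit

/-! ## §9 Non-vacuity at the flat datum -/

section NonVacuity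

variable (F : T3Family) (n K : ℕ)

/-- **(19) IS MET BY THE ZERO EXPONENT AT THE TRIVIAL PERTURBATION** (`U₁ ≡ 1 = e^{i·0}`, every bound reads `0 < ε₂ηᵃ`), for any background and
any `ε₂ > 0`. [cite: Balaban1985Variational, (19) p.281] -/
theorem in19_one_zero {ε₂ : ℝ} (hε₂ : 0 < ε₂) (U₀ : GaugeField (F.P K) 0 (Matrix.specialUnitaryGroup (Fin 2) ℂ)) :
    In19 F n K ε₂ U₀ (1 : GaugeField (F.P K) 0 (Matrix.specialUnitaryGroup (Fin 2) ℂ)) (fun _ => 0) := by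
  have hη : 0 < eta F n K := eta_pos F n K
  refine ⟨fun b => ⟨Matrix.isHermitian_zero, Matrix.trace_zero _ _⟩, fun b => ?_, fun b => ?_, fun μ ν x => ?_, fun μ x => ?_, fun ν x => ?_⟩
  · rw [smul_zero, exp_zero]; rfl
  · rw [norm_zero]; exact mul_pos hε₂ hη
  · rw [covGradT_zero, norm_zero]; exact mul_pos hε₂ (pow_pos hη 2)
  · rw [covCodiffCurlT_zero, norm_zero]; exact mul_pos hε₂ (pow_pos hη 3)
  · rw [covLapFormT_zero, norm_zero]; exact mul_pos hε₂ (pow_pos hη 3)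

/-- **(14) IS MET BY THE TRIVIAL BACKGROUND OVER THE TRIVIAL DATUM** for all radii `a, b > 0` (`1 ∈ 𝔘_k(a)`, `1̄ = 1`).
[cite: Balaban1985Variational, (14) p.280] -/
theorem sat14T3_one (h : n ≤ K) {a b : ℝ} (ha : 0 < a) (hb : 0 < b) :
    Sat14T3 F n K h a b (1 : GaugeField (F.P n) 0 (Matrix.specialUnitaryGroup (Fin 2) ℂ))
      (1 : GaugeField (F.P K) 0 (Matrix.specialUnitaryGroup (Fin 2) ℂ)) :=
  sat14T3_of_mem_fibre hb (regPr_one ha) (one_mem_regFibrePr_one F (h := h) ha).1.1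

end NonVacuity

/-! ## §10 (v1.1, append-only) The chart (19) in the consumers' exp-free letters at the trivial background -/

section FlatReading

variable {F : T3Family} {n K : ℕ}

/-- **THE BOND RADIUS OF THE 19200 V3-F♭ FILES FROM (19)**: `U₁ = e^{iX}` with `‖X‖ < ε₂η` gives `‖U₁(b) − 1‖ < ε₂η = ε₂L^{−(K−n)}` — by
[Balaban1985Averaging] (24) «|exp iA − 1| ≦ |A|» for Hermitian `A` (tree: `B8Ineq170.norm_exp_I_smul_sub_one_le`, C⋆-reading of `M₂(ℂ)` via
`B10Eq29TubeLine.cstarAlgebraMatrix`); this is the hypothesis `hδ` of `Summit…Prop7FlatLocalMin.wilsonAction4_ge_of_regPr_T3`.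
[cite: Balaban1985Variational, (19) p.281; Balaban1985Averaging, (24) p.21] -/
theorem In19.norm_sub_one_lt {ε₂ : ℝ} {U₀ U₁ : GaugeField (F.P K) 0 (Matrix.specialUnitaryGroup (Fin 2) ℂ)}
    {X : PBond (F.P K) 0 → Matrix (Fin 2) (Fin 2) ℂ} (hX : In19 F n K ε₂ U₀ U₁ X) (b : PBond (F.P K) 0) :
    ‖((U₁ b : Matrix.specialUnitaryGroup (Fin 2) ℂ) : Matrix (Fin 2) (Fin 2) ℂ) - 1‖ < ε₂ * ((F.L : ℝ)⁻¹) ^ (K - n) := by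
  letI : CStarAlgebra (Matrix (Fin 2) (Fin 2) ℂ) := B10Eq29TubeLine.cstarAlgebraMatrix 2
  rw [hX.2.1 b]
  exact (B8Ineq170.norm_exp_I_smul_sub_one_le (hX.1 b).1.isSelfAdjoint).trans_lt (hX.2.2.1 b)

/-- At the trivial background the letters of `bgUnits` are the trivial units configuration (`T3PrintedRegularMinimiser.unitsField_toUField_one`).
[cite: Balaban1985Averaging, (19) p.21] -/
theorem bgUnits_one : bgUnits F K (1 : GaugeField (F.P K) 0 (Matrix.specialUnitaryGroup (Fin 2) ℂ)) = fun _ => 1 :=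
  unitsField_toUField_one

/-- (15) at the trivial background: `U′ = U` (`pert 1 U = U`). [cite: Balaban1985Variational, (15) p.280] -/
theorem pert_one (U : GaugeField (F.P K) 0 (Matrix.specialUnitaryGroup (Fin 2) ℂ)) :
    pert (1 : GaugeField (F.P K) 0 (Matrix.specialUnitaryGroup (Fin 2) ℂ)) U = U := by
  funext b; simp [pert]; rfl

/-- (15) at the trivial background: `U′U₀ = U′` (`emb15 1 U′ = U′`). [cite: Balaban1985Variational, (15) p.280] -/
theorem emb15_one (U' : GaugeField (F.P K) 0 (Matrix.specialUnitaryGroup (Fin 2) ℂ)) :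
    emb15 (1 : GaugeField (F.P K) 0 (Matrix.specialUnitaryGroup (Fin 2) ℂ)) U' = U' := by
  funext b; simp [emb15]; rfl

/-- **(19) AT THE TRIVIAL BACKGROUND, IN THE FLAT VOCABULARY OF `LatticeFieldCalculus`** (the 19200 V3-♭ files' letters, unit lattice factor
`c = 1`): the gradient member is `‖∂_μ X_ν‖ < ε₂η²` (`pdiff 1`), the Laplacian member `‖ΔX_ν‖ < ε₂η³` (`laplace 1`); the bond member and the
`D*D` member are unchanged (the latter's flat form is `covCodiffCurlT 1 1`, the codifferential of `curl 1`, §2.2).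
[cite: Balaban1985Variational, (19) p.281; Balaban1984PropagatorsI, (1.2) p.18, (1.21) p.21] -/
theorem in19_one_iff {ε₂ : ℝ} {U₁ : GaugeField (F.P K) 0 (Matrix.specialUnitaryGroup (Fin 2) ℂ)} {X : PBond (F.P K) 0 → Matrix (Fin 2) (Fin 2) ℂ} :
    In19 F n K ε₂ (1 : GaugeField (F.P K) 0 (Matrix.specialUnitaryGroup (Fin 2) ℂ)) U₁ X ↔
      (∀ b : PBond (F.P K) 0, (X b).IsHermitian ∧ Matrix.trace (X b) = 0) ∧
      (∀ b : PBond (F.P K) 0, ((U₁ b : Matrix.specialUnitaryGroup (Fin 2) ℂ) : Matrix (Fin 2) (Fin 2) ℂ) = exp (Complex.I • X b)) ∧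
      (∀ b : PBond (F.P K) 0, ‖X b‖ < ε₂ * eta F n K) ∧
      (∀ (μ ν : Fin (F.P K).d) (x : Site (F.P K) 0), ‖LatticeFieldCalculus.pdiff 1 μ (formComp X ν) x‖ < ε₂ * eta F n K ^ 2) ∧
      (∀ (μ : Fin (F.P K).d) (x : Site (F.P K) 0),
        ‖covCodiffCurlT 1 (fun _ : PBond (F.P K) 0 => (1 : (Matrix (Fin 2) (Fin 2) ℂ)ˣ)) X μ x‖ < ε₂ * eta F n K ^ 3) ∧
      (∀ (ν : Fin (F.P K).d) (x : Site (F.P K) 0), ‖LatticeFieldCalculus.laplace 1 (formComp X ν) x‖ < ε₂ * eta F n K ^ 3) := by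
  unfold In19
  rw [bgUnits_one]
  simp only [covGradT, covDerivFwdT_one, covLapFormT_one, inv_one]

end FlatReading

end Literature.MathematicalPhysics.QuantumFieldTheory.Balaban1983to89.T3SectALandauChart

end
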